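import Summits.FinalStateConjecture.FinalStateConjecture.Theses.PhotonSphereChannels
import Summits.FinalStateConjecture.FinalStateConjecture.Theorems.PhotonSphereChannelsCauchyWave
import Summits.FinalStateConjecture.FinalStateConjecture.Theorems.ChannelsResolveTameDevelopmentsR.Negative.SlabMinkowskiLoadBearing
import Summits.FinalStateConjecture.FinalStateConjecture.Theorems.ChannelsResolveTameDevelopmentsR.Negative.SubMinkowskiSettledT2
import Literature.Geometry.Lorentzian.ReggeWheelerChannels
import Literature.Geometry.Lorentzian.ReggeWheelerTortoise

/-!
# Disproof of `ChannelsResolveTameDevelopmentsR` (K2R) — findings (cdisprove, cycles 1–3; cycle 3 =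
# the T2 re-type, item `stmt-FinalStateConjecture-17430`, 2026-08-17)

Crux `stmt-FinalStateConjecture-17430` of route `PhotonSphereChannels` (rev 15/16) is the implication
`K2R : UniformPhotonSphereChannelsR → Φ`, where the antecedent `K1R` (item 14074, rank 2) is the
repaired LOG-BALL channel-of-energy inequality for the Regge–Wheeler family on Schwarzschild — now a
THEOREM of the tree (`UniformPhotonSphereChannelsR_holds`), so that **K2R ↔ Φ unconditionally**
(`k2R_iff_tameResolution`, §1) — and the consequent `Φ = Φ_T2` (`TameResolution` below, RE-TYPED this
cycle to the rev-15 body) is tame final-state resolution with the FULL T2 conclusion: every MGHD of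
admissible data with complete `𝓘⁺`, (i) no `C²` late chart converging to a boosted EXTREMAL Kerr
exterior and (ii) uniformly `C³`-bounded geometry of the outer region, admits an honest
`FinalStateDecomposition` with `O = exteriorOf 𝒟 d.charted`, `RaysStayInClosure 𝒟 O` (every
future-complete normalised null ray from `Σ` stays in `closure O`), `HasExhaustiveCharts d` (honest
radii) and `IsFutureOriented d`. The rev-14 consequent (item 14075) is kept as `TameResolutionOld`; it is
a COROLLARY of the new one (`tameResolutionOld_of_tameResolution`), so every negative result on 14075
transfers (`not_tameResolution_of_not_old`).

**Verdict (cycles 1–3): no kill, and no kill is typable in the present tree** (the obstruction is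
unchanged: `IsMaximal` is certifiable for no development, §3). All statements below are `lean check`ed
(rc 0); prose lives in docstrings; there is no `sorry` in this file.

Cycle-3 findings (T2-specific; details §8):
* §8.1 the three clauses the re-type ADDED have different status. (C) `RaysStayInClosure` is the ONE
  live exposure: on a one-ended `Σ = ℝ³ # N` with a hidden expanding vacuum bag (CIP gluing) a
  future-complete ray in the bag lies outside `closure O` for every honest exhaustive `d` — FALSE ON
  PAPER modulo three dynamical expectations, not constructible in Lean (needs the MGHD of glued data);
  it bites summit clause (C) equally and is an OPERATOR-level question (filed by rattack/rreview/ideators;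
  `bag_exposure`). (B) `IsFutureOriented` is NOT a place where Φ_T2 can fail: clauses (ii)/(iii) are
  implied on paper by honesty `O ⊆ J⁺(Σ)` + achronality of the Cauchy surface + infinite proper length of
  chart-time lines, and clause (i) is a bookkeeping normalisation; KERNEL-CHECKED on the certifiable
  (flat) class for hole-free decompositions (`Negative/SubMinkowskiOrientation.lean`, p134132, LANDED this cycle).
  Honest radii in `HasExhaustiveCharts` only strengthen the old clause (monotone, `tameResolutionOld_of_tameResolution`).
* §8.2 hypothesis (ii) as typed is LORENTZ-PANCAKE-BLIND: the `r₀`-ball charts may be arbitrarily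
  boosted, so (ii) bounds no injectivity radius (the flat cylinder `E4/(Lℤ e₃)` is (ii)-tame at EVERY
  scale `r₀`, kernel-checked on the cover: `Negative/TameChartsBoostBlind.lean`, p134429, LANDED this cycle). For the
  crux this WEAKENS the hypothesis (more developments qualify — e.g. Kasner-type bags), and it tells
  provers that no stub may extract non-collapse from (ii).
* §4 `not_tameResolutionAllDevelopments`: the T2 body with `IsMaximal` AND complete `𝓘⁺` deleted is
  FALSE (landed slab witness, by monotonicity) — the one `_false_without_` theorem of this file; Φ_T2
  without `IsMaximal` alone HOLDS on the whole flat class (`Negative/SubMinkowskiSettledT2`, cited in §4).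

1. §1 `k2R_iff` … `k1R_and_not_tameResolution_of_not_k2R`: the implication carries no logical
   strength of its own — `¬K1R → K2R`, `Φ → K2R`, `¬K2R → K1R ∧ ¬Φ`; `Φ ∧ TameCensorship → FSC`
   without `K1R` (the antecedent is formally inert: no declaration of the tree links
   `ReggeWheeler.ChannelInequality` to `VacuumCauchyDevelopment`). Independently found by the
   crux-attack seat (`CruxAttack.lean`, evidence on the item, refuter-rattack-14075); re-derived here
   so that this file is self-contained.
2. §2 the antecedent lattice: `K1 → K1R ↔ LogBall → FixedModeChannels` (`K1` = the refuted fixed-ball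
   statement, inlined since its decl was dropped at rev 7; `LogBall` = repair (a) of the cdisprove seat
   of 10046). Hence `(FixedModeChannels → Φ) → K2R` and `¬FixedModeChannels → K2R`: if the per-mode
   rung (item 10048, far half unproved) or the log-ball crux K1R falls on its open FAR side, K2R is
   again vacuously true and unrefutable, exactly like K2.
3. §3 `¬K2R ↔ K1R ∧ Nonempty TameNonSettlingWitness`: the precise object a refutation must build —
   a proof of K1R (open, XL) AND an admissible datum with a CERTIFIED-MAXIMAL vacuum Cauchy development
   that is complete, sub-extremal-ended, tame and non-settling. No `VacuumCauchyDevelopment` of the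
   tree can be certified `IsMaximal` (Choquet-Bruhat–Geroch is not formalised), so neither a
   models-refutation nor a models-proof of Φ is typable today (§3 docstrings; also rattack's note).
4. §4 LOAD-BEARING ANALYSIS of Φ's hypotheses (defs `TameResolutionWithout…`, each trivially
   `→ Φ`, with the on-paper status of the converse): (i) is NOT load-bearing for Φ itself (its
   conclusion allows `|a| = M`; (i) only serves the Assembly's sub-extremality and removes rough
   extremal ω-limits, which (ii) removes anyway via Aretakis growth inside the closed balls);
   `IsMaximal` is morally redundant GIVEN complete `𝓘⁺` in the sojourn form (a removed future set
   visible from infinity is met by aimed-in null rays after bounded sojourn, so completeness forces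
   future-maximality of the visible region); `IsMaximal` and complete `𝓘⁺` are JOINTLY load-bearing
   (time-truncated Minkowski `{t < T}`: tame, sub-extremal, but no flat late chart fits — its
   `x⁰`-lines have unbounded proper time, §4 docstring); (ii) is load-bearing (naked-singularity and
   rough-extremal developments are removed only by it).
5. §5 Φ itself: candidate counterexample classes and their printed status — AF vacuum breathers /
   time-periodic solutions (excluded only near `𝓘` or under analyticity: Papapetrou, Gibbons–Stewart
   1984, Bičák–Scholtz–Tod 2010, Alexakis–Schlue arXiv:1504.04592), smooth non-Kerr stationary black
   holes (uniqueness without analyticity open: Alexakis–Ionescu–Klainerman, Ionescu–Klainerman),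
   non-dispersing horizonless lumps (large-data dispersal open), eternal binaries (radiation-reaction
   folklore, no theorem); infinitely many holes and far-out late collapse are excluded by the `o₂(r⁻¹)`
   decay of admissible data (hoop count in the docstring); Kehle–Unger exact-Kerr collapse exteriors
   SATISFY Φ (the tree's `Kerr.bilin` is the genuine Kerr–Schild form, checked against Visser (32)–(35)).
   Φ ⊇ {non-radiating ⇒ stationary} ∘ {stationary ⇒ Kerr} on the tame locus, both open both ways:
   the planner's `[open-problem]` tag is accurate and a refutation would itself be a major theorem.
6. §6 near-misses / targets: none this cycle (no line registered under 14075; the three Φ-lines of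
   10046 transfer verbatim — drefute g2: stub C `stub_eternalDoublySilentRigidity` false as typed
   (`|a| < M`; repair `|a| ≤ M`, `Negative/EmptyHorizonEnd.lean` p76400), A, B, Q, D, E1, E2 survive).
7. §7 (cycle 2, 2026-08-16T04Z) PRE-SCREEN of the four round-1 crux-ideate first lemmas, typed
   here as read from the cards (L1 `SilentModesAreStatic`, L2 `TwoSidedTrappingTime`, L3
   `StableSetSwallowsOmegaLimit` (prose), L4 `EternalSilentWavesVanish`): none falls to a cheap
   attack (free-model / scattering / semiclassical checks in the docstrings); `L4 → L1`
   (`silentModesAreStatic_of_eternalSilentWavesVanish`: the channel inequality in L1 is a proof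
   device, not a truth condition).  LOAD-BEARING quantifiers, settled in Lean: the `∀ T` (all
   centres) IS load-bearing — `exists_oneTimeSilent_nonstatic` (explicit finite-energy solution,
   data `(0, bump)` in the ball, silent at base time `0` through every channel `ρ ≥ ρ₀`, both
   directions, `ψ ≢ 0`), hence `not_oneTimeSilenceStatic`, `not_oneTimeSilenceZero` (refuted natural
   strengthenings, category (c)); the `∀ ρ ≥ ρ₀` is NOT (≡ `ρ = ρ₀`, `silentFrom_iff_silentAt`), and
   given all centres the aperture itself is NOT (`silentAllCentres_iff_aperture_zero`,
   `eternalSilentWavesVanish_iff₀ : L4 ↔ L4₀`); on the time-symmetric class every two-sided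
   (`∓T`) hypothesis is ONE condition (`twoSided_hypotheses_coincide_of_even`).  The same theorems,
   minus the `def`s, are LANDED as `Theorems/ChannelsResolveTameDevelopmentsR/Negative/
   SilenceCalculus.lean` (p81766 ACCEPTED 2026-08-16T05:15Z, commit d5ff2cacdf61, `--supports`
   14075; namespace `…Theorems.ChannelsResolveTameDevelopmentsR.Negative`, importable by lines).
8. Cycle-2 census additions (`tameResolution_resists_c2`): the antecedent can only ever work on
   developments with a SCHWARZSCHILD (`a = 0`) ω-limit — K1R/FixedModeChannels are Regge–Wheeler
   statements, no Teukolsky/Kerr channel exists in the tree, and Dafermos–Luk expect `a_i ≠ 0`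
   generically: on the generic development K2R's hypothesis is again inert; the decisive external
   event remains K1R's far side (item 14074: rattack "survives; decisive falsifier cos θ_F via Jost
   functions", planner far-side assessment, compute j011935 — evidence store not readable from this
   seat); literature pass 2026-08-16T04Z degraded (local FTS down, OpenAlex/S2 429; arXiv: only
   Alexakis–Schlue 1504.04592) — no new breather/rigidity-without-analyticity result surfaced.

Namespace as prescribed by the cdisprove protocol.
-/

noncomputable section

set_option linter.dupNamespace false

open scoped BigOperators Topology Manifold ENNReal
open Filter Set Function MeasureTheory

namespace Summit.FinalStateConjecture.FinalStateConjecture.Cruxes.ChannelsResolveTameDevelopmentsR.Disproof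

open Summit.FinalStateConjecture.FinalStateConjecture.Theses.PhotonSphereChannels
open Literature.Geometry.Lorentzian Literature.Geometry.Lorentzian.ReggeWheeler

/-! ## 1. The consequent `Φ` and the logical anatomy of K2R -/

/-- **`Φ` = `Φ_T2` = `TameResolution`**: the consequent of `ChannelsResolveTameDevelopmentsR` at rev
15/16, verbatim (`k2R_iff : K2R ↔ (K1R → Φ) := Iff.rfl`). For every admissible datum and every MGHD
with complete `𝓘⁺` such that (i) no late chart converges in `C²` on all near-zone slabs to a boosted
EXTREMAL Kerr exterior and (ii) the outer region `J⁺(Σ) ∩ ⋃ I⁻(future branches of future-complete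
normalised null rays from Σ)` has uniformly `C³`-bounded, `C⁰`-pinched geometry in coordinate balls of
one fixed radius, there is an honest `2`-decomposition `d` with `O = exteriorOf 𝒟 d.charted`,
`RaysStayInClosure 𝒟 O`, `HasExhaustiveCharts d` (honest radii) and `IsFutureOriented d` — the T2
conclusion of the summit minus sub-extremality (which `closes` derives from (i)). The rev-14 body is
`TameResolutionOld`. [cite: DafermosLuk2017, Conjecture 1 and §1.2.1] -/
def TameResolution : Prop :=
  ∀ (X : Type) [TopologicalSpace X] [ChartedSpace Literature.Geometry.Lorentzian.E3 X] [IsManifold (modelWithCornersSelf ℝ Literature.Geometry.Lorentzian.E3) ((⊤ : ℕ∞) : WithTop ℕ∞) X] [T2Space X] [SecondCountableTopology X] [ConnectedSpace X], ∀ D ∈ Literature.Geometry.Lorentzian.admissibleVacuumData X, ∀ 𝒟 : Literature.Geometry.Lorentzian.VacuumCauchyDevelopment D, 𝒟.IsMaximal → _root_.Summit.FinalStateConjecture.HasCompleteNullInfinity 𝒟.toCauchyDevelopment → ((∀ (Λ : Literature.Geometry.Lorentzian.lorentzGroup) (c : Literature.Geometry.Lorentzian.E4) (M a : ℝ), Literature.Geometry.Lorentzian.Kerr.IsExtremal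 M a → ¬ ∃ (τ₀ : ℝ) (Ψ : (Literature.Geometry.Lorentzian.boostedKerrBackground Λ c M a).domain → 𝒟.carrier), 𝒟.toSpacetime.IsLateChart (Literature.Geometry.Lorentzian.boostedKerrBackground Λ c M a) Set.univ τ₀ Ψ ∧ ∀ R : ℝ, Filter.Tendsto (fun τ => 𝒟.toSpacetime.truncDeviationCk (Literature.Geometry.Lorentzian.boostedKerrBackground Λ c M a) Ψ 2 R τ) Filter.atTop (nhds 0)) ∧ ∀ [𝒟.metric.HasLeviCivita], let outer : Set 𝒟.carrier := 𝒟.metric.causalFuture 𝒟.timeOrientation (Set.range 𝒟.embed) ∩ {q | ∃ (p : X) (γ : ℝ → 𝒟.carrier) (dom : Set ℝ), 𝒟.metric.IsNormalisedNullRayFrom 𝒟.timeOrientation 𝒟.embed 𝒟.normal p γ dom ∧ ¬ BddAbove dom ∧ q ∈ 𝒟.metric.chronologicalPast 𝒟.timeOrientation (γ '' (dom ∩ Set.Ici 0))}; ∃ r₀ : ℝ, 0 < r₀ ∧ ∃ Λ : NNReal, ∀ q ∈ outer, let U : TopologicalSpace.Opens Literature.Geometry.Lorentzian.E4 := ⟨Metric.ball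 (0 : Literature.Geometry.Lorentzian.E4) r₀, Metric.isOpen_ball⟩; ∃ Ψ : U → 𝒟.carrier, 𝒟.toSpacetime.IsLateChart (Literature.Geometry.Lorentzian.Minkowski.backgroundOn U) Set.univ (-r₀) Ψ ∧ (∃ x : U, (x : Literature.Geometry.Lorentzian.E4) = 0 ∧ Ψ x = q) ∧ Literature.Geometry.Lorentzian.supCkENorm (U : Set Literature.Geometry.Lorentzian.E4) 3 (𝒟.toSpacetime.deviationExtend (Literature.Geometry.Lorentzian.Minkowski.backgroundOn U) Ψ) ≤ (Λ : ENNReal) ∧ Literature.Geometry.Lorentzian.supCkENorm (U : Set Literature.Geometry.Lorentzian.E4) 0 (𝒟.toSpacetime.deviationExtend (Literature.Geometry.Lorentzian.Minkowski.backgroundOn U) Ψ) ≤ 1 / 2) → ∃ (O : Set 𝒟.carrier) (d : Literature.Geometry.Lorentzian.FinalStateDecomposition 𝒟.toSpacetime O 2), O = _root_.Summit.FinalStateConjecture.exteriorOf 𝒟.toCauchyDevelopment d.charted ∧ _root_.Summit.FinalStateConjecture.RaysStayInClosure 𝒟.toCauchyDevelopment O ∧ _root_.Summit.FinalStateConjecture.HasExhaustiveCharts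 d ∧ _root_.Summit.FinalStateConjecture.IsFutureOriented d

/-- **`Φ_old` = `TameResolutionOld`**: the rev-7/14 consequent (item `stmt-FinalStateConjecture-14075`,
byte-identical to cycles 1–2 of this file): same hypotheses, conclusion only `O = exteriorOf 𝒟 d.charted ∧
HasExhaustiveCharts d`. Kept because the landed negative lemmas (`Negative/SlabMinkowskiLoadBearing`,
`Negative/SubMinkowskiSettled`) are stated against it; it is a COROLLARY of `TameResolution`
(`tameResolutionOld_of_tameResolution`). [cite: DafermosLuk2017, Conjecture 1 and §1.2.1] -/
def TameResolutionOld : Prop :=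
  ∀ (X : Type) [TopologicalSpace X] [ChartedSpace Literature.Geometry.Lorentzian.E3 X] [IsManifold (modelWithCornersSelf ℝ Literature.Geometry.Lorentzian.E3) ((⊤ : ℕ∞) : WithTop ℕ∞) X] [T2Space X] [SecondCountableTopology X] [ConnectedSpace X], ∀ D ∈ Literature.Geometry.Lorentzian.admissibleVacuumData X, ∀ 𝒟 : Literature.Geometry.Lorentzian.VacuumCauchyDevelopment D, 𝒟.IsMaximal → _root_.Summit.FinalStateConjecture.HasCompleteNullInfinity 𝒟.toCauchyDevelopment → ((∀ (Λ : Literature.Geometry.Lorentzian.lorentzGroup) (c : Literature.Geometry.Lorentzian.E4) (M a : ℝ), Literature.Geometry.Lorentzian.Kerr.IsExtremal M a → ¬ ∃ (τ₀ : ℝ) (Ψ : (Literature.Geometry.Lorentzian.boostedKerrBackground Λ c M a).domain → 𝒟.carrier), 𝒟.toSpacetime.IsLateChart (Literature.Geometry.Lorentzian.boostedKerrBackground Λ c M a) Set.univ τ₀ Ψ ∧ ∀ R : ℝ, Filter.Tendsto (fun τ => 𝒟.toSpacetime.truncDeviationCk (Literature.Geometry.Lorentzian.boostedKerrBackground Λ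 c M a) Ψ 2 R τ) Filter.atTop (nhds 0)) ∧ ∀ [𝒟.metric.HasLeviCivita], let outer : Set 𝒟.carrier := 𝒟.metric.causalFuture 𝒟.timeOrientation (Set.range 𝒟.embed) ∩ {q | ∃ (p : X) (γ : ℝ → 𝒟.carrier) (dom : Set ℝ), 𝒟.metric.IsNormalisedNullRayFrom 𝒟.timeOrientation 𝒟.embed 𝒟.normal p γ dom ∧ ¬ BddAbove dom ∧ q ∈ 𝒟.metric.chronologicalPast 𝒟.timeOrientation (γ '' (dom ∩ Set.Ici 0))}; ∃ r₀ : ℝ, 0 < r₀ ∧ ∃ Λ : NNReal, ∀ q ∈ outer, let U : TopologicalSpace.Opens Literature.Geometry.Lorentzian.E4 := ⟨Metric.ball (0 : Literature.Geometry.Lorentzian.E4) r₀, Metric.isOpen_ball⟩; ∃ Ψ : U → 𝒟.carrier, 𝒟.toSpacetime.IsLateChart (Literature.Geometry.Lorentzian.Minkowski.backgroundOn U) Set.univ (-r₀) Ψ ∧ (∃ x : U, (x : Literature.Geometry.Lorentzian.E4) = 0 ∧ Ψ x = q) ∧ Literature.Geometry.Lorentzian.supCkENorm (U : Set Literature.Geometry.Lorentzian.E4)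 3 (𝒟.toSpacetime.deviationExtend (Literature.Geometry.Lorentzian.Minkowski.backgroundOn U) Ψ) ≤ (Λ : ENNReal) ∧ Literature.Geometry.Lorentzian.supCkENorm (U : Set Literature.Geometry.Lorentzian.E4) 0 (𝒟.toSpacetime.deviationExtend (Literature.Geometry.Lorentzian.Minkowski.backgroundOn U) Ψ) ≤ 1 / 2) → ∃ (O : Set 𝒟.carrier) (d : Literature.Geometry.Lorentzian.FinalStateDecomposition 𝒟.toSpacetime O 2), O = _root_.Summit.FinalStateConjecture.exteriorOf 𝒟.toCauchyDevelopment d.charted ∧ _root_.Summit.FinalStateConjecture.HasExhaustiveCharts d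

/-- **Monotonicity of the re-type**: Φ_T2 ⇒ Φ_old (forget the ray-closure and orientation clauses; the
honest-radii `HasExhaustiveCharts` is the same predicate name, re-typed in the Statement file, so nothing
is forgotten there). Hence every refutation of Φ_old refutes Φ_T2 (`not_tameResolution_of_not_old`) and
the cycle-1/2 analysis below transfers verbatim. [folklore] -/
theorem tameResolutionOld_of_tameResolution (h : TameResolution) : TameResolutionOld := by
  intro X _ _ _ _ _ _ D hD 𝒟 hmax hcomp hyp
  obtain ⟨O, d, hO, -, hexh, -⟩ := h X D hD 𝒟 hmax hcomp hyp
  exact ⟨O, d, hO, hexh⟩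

/-- `¬Φ_old → ¬Φ_T2`: negative knowledge on item 14075 is negative knowledge on item 17430. [folklore] -/
theorem not_tameResolution_of_not_old (h : ¬ TameResolutionOld) : ¬ TameResolution :=
  fun hΦ ↦ h (tameResolutionOld_of_tameResolution hΦ)

/-- K2R is literally `K1R → Φ`. [folklore] -/
theorem k2R_iff : ChannelsResolveTameDevelopmentsR ↔ (UniformPhotonSphereChannelsR → TameResolution) :=
  Iff.rfl

/-- **Ex-falso inheritance.** If the rank-2 crux `K1R` is false (its FAR side is the route's own
declared kill criterion), K2R holds vacuously and cannot be refuted as typed — the fate of K2. [folklore] -/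
theorem k2R_of_not_k1R (h : ¬ UniformPhotonSphereChannelsR) : ChannelsResolveTameDevelopmentsR :=
  fun h₁ ↦ absurd h₁ h

/-- If `K1R` holds, K2R is exactly `Φ`. [folklore] -/
theorem k2R_iff_tameResolution_of_k1R (h : UniformPhotonSphereChannelsR) :
    ChannelsResolveTameDevelopmentsR ↔ TameResolution :=
  ⟨fun h₂ ↦ h₂ h, fun hΦ _ ↦ hΦ⟩

/-- **K2R ↔ Φ_T2, UNCONDITIONALLY** (cycle 3): `K1R` is a theorem of the tree
(`UniformPhotonSphereChannelsR_holds` = `Theorems.uniformPhotonSphereChannelsR_proof`, item 14074 closed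
2026-08-16T17:53Z), so the antecedent is discharged and the crux IS tame T2 resolution; the ex-falso door
`k2R_of_not_k1R` is shut for good. (Lead c2's `K2REquivPhi.k2R_iff_tameResolution` is this statement over
the rev-14 body; it re-elaborates against the re-typed `TameResolution` through this file.) [folklore] -/
theorem k2R_iff_tameResolution : ChannelsResolveTameDevelopmentsR ↔ TameResolution :=
  k2R_iff_tameResolution_of_k1R UniformPhotonSphereChannelsR_holds

/-- `Φ` alone implies K2R: the only typable proof route (intro the K1R hypothesis, never use it). [folklore] -/
theorem k2R_of_tameResolution (hΦ : TameResolution) : ChannelsResolveTameDevelopmentsR := fun _ ↦ hΦ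

/-- … and K2R now yields `Φ` outright. [folklore] -/
theorem tameResolution_of_k2R (h : ChannelsResolveTameDevelopmentsR) : TameResolution :=
  k2R_iff_tameResolution.1 h

/-- K2R also yields the OLD consequent (item 14075's Φ): `¬Φ_old` refutes the present item. [folklore] -/
theorem tameResolutionOld_of_k2R (h : ChannelsResolveTameDevelopmentsR) : TameResolutionOld :=
  tameResolutionOld_of_tameResolution (tameResolution_of_k2R h)

/-- **Any refutation of K2R proves `K1R` and refutes `Φ`.** [folklore] -/
theorem k1R_and_not_tameResolution_of_not_k2R (h : ¬ ChannelsResolveTameDevelopmentsR) :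
    UniformPhotonSphereChannelsR ∧ ¬ TameResolution := by
  by_contra hc
  rw [not_and_or, not_not] at hc
  rcases hc with h₁ | hΦ
  · exact h (k2R_of_not_k1R h₁)
  · exact h (k2R_of_tameResolution hΦ)

/-- K2R is equivalent to "`K1R` false or `Φ` true": its truth value is a function of two CLOSED
statements, one linear (Schwarzschild, 1+1) and one about all tame MGHDs; no information flows
between them inside the tree. [folklore] -/
theorem k2R_iff_not_k1R_or : ChannelsResolveTameDevelopmentsR ↔ (¬ UniformPhotonSphereChannelsR ∨ TameResolution) :=
  ⟨fun h ↦ (em UniformPhotonSphereChannelsR).elim (fun h₁ ↦ Or.inr (h h₁)) Or.inl,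
    fun h ↦ h.elim k2R_of_not_k1R k2R_of_tameResolution⟩

/-- **`K1R` is not a logical input of the route**: `Φ` and `TameCensorship` already give the summit
statement (the deciding theorem `closes` re-run with `Φ` in place of `K2R K1R`). [folklore] -/
theorem finalState_of_tameResolution (hΦ : TameResolution) (h₃ : TameCensorship) :
    _root_.FinalStateConjecture := by
  intro X i₁ i₂ i₃ i₄ i₅ i₆
  -- TAME Christodoulou-genericity (T2) is monotone in the property, exactly as in `closes`
  have mono : ∀ {P Q : _ → Prop},
      (∀ D ∈ Literature.Geometry.Lorentzian.admissibleVacuumData X, Q D → P D) →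
      Literature.Geometry.Lorentzian.InitialDataSet.IsTameChristodoulouGeneric
        (Literature.Geometry.Lorentzian.admissibleVacuumData X) Q 1 →
      Literature.Geometry.Lorentzian.InitialDataSet.IsTameChristodoulouGeneric
        (Literature.Geometry.Lorentzian.admissibleVacuumData X) P 1 := by
    intro P Q hQP hQ D hD
    obtain ⟨e, F, hF, himm, h0, hinj, hadm, hexc⟩ := hQ D ⟨hD.1, fun h => hD.2 (hQP D hD.1 h)⟩
    exact ⟨e, F, hF, himm, h0, hinj, hadm,
      fun c hc hmem => hexc c hc ⟨hmem.1, fun h => hmem.2 (hQP _ hmem.1 h)⟩⟩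
  refine mono ?_ (h₃ X)
  rintro D hD ⟨hex, hQ⟩
  refine ⟨hex, fun 𝒟 hmax => ?_⟩
  obtain ⟨hcomp, htame⟩ := hQ 𝒟 hmax
  obtain ⟨O, d, hO, hrays, hexh, hfo⟩ := hΦ X D hD 𝒟 hmax hcomp htame
  refine ⟨hcomp, O, d, fun i => ?_, hO, hrays, hexh, hfo⟩
  rcases lt_or_eq_of_le (d.abs_spin_le_mass i) with hlt | heq
  · exact hlt
  · exact absurd ⟨d.τ₀, d.chart i, ⟨(d.isLateChart i).contMDiff,
        (d.isLateChart i).isOpenEmbedding, Set.subset_univ _⟩, d.tendsto_truncDeviationCk i⟩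
      (htame.1 (d.motion i).1 (d.motion i).2 (d.mass i) (d.spin i) ⟨heq, d.mass_pos i⟩)

/-- The route's hypotheses `K1R ∧ K2R ∧ K3` are jointly equivalent to `K1R ∧ Φ ∧ K3`; in particular
they are CONSISTENT only if `Φ` is true — a refutation of `Φ` kills the route even though it would
not by itself refute the item K2R. [folklore] -/
theorem hypotheses_iff :
    (UniformPhotonSphereChannelsR ∧ ChannelsResolveTameDevelopmentsR ∧ TameCensorship) ↔
      (UniformPhotonSphereChannelsR ∧ TameResolution ∧ TameCensorship) :=
  ⟨fun ⟨h₁, h₂, h₃⟩ ↦ ⟨h₁, h₂ h₁, h₃⟩, fun ⟨h₁, hΦ, h₃⟩ ↦ ⟨h₁, fun _ ↦ hΦ, h₃⟩⟩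

/-! ## 2. The antecedent lattice `K1 → K1R ↔ LogBall → FixedModeChannels` -/

/-- The REFUTED fixed-ball statement K1 (`UniformPhotonSphereChannels`, item 10045, refuted by
`Theorems.not_UniformPhotonSphereChannels`, p75070), restated over the Literature vocabulary (its
decl was dropped from the route file at rev 7): one `ℓ`-uniform constant on every fixed ball
`ρ ≥ ρ₀(M)`. Kept here only to place K1R in the lattice. [cite: KenigEtAl2015, §1] -/
def FixedBallChannels : Prop :=
  ∀ M : ℝ, 0 < M → ∃ ρ₀ : ℝ, 0 ≤ ρ₀ ∧ ∃ c : ℝ, 0 < c ∧ ∀ (r : ℝ → ℝ) (xc : ℝ),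
    IsTortoiseRadius M r xc → ∀ (s ℓ : ℕ), s ≤ 2 → s ≤ ℓ → ∀ ρ : ℝ, ρ₀ ≤ ρ →
      ChannelInequality (linePotential M s ℓ r) xc ρ c

/-- Repair (a) of the cdisprove seat of 10046 (`UniformPhotonSphereChannelsLogBall` in the old
`Cruxes/ChannelsResolveTameDevelopments/Disproof.lean`): ONE constant `C(M)` and balls
`ρ ≥ C · (1 + log(ℓ+1))`. [cite: KenigEtAl2015, §1] -/
def LogBallChannels : Prop :=
  ∀ M : ℝ, 0 < M → ∃ C : ℝ, 0 ≤ C ∧ ∃ c : ℝ, 0 < c ∧ ∀ (r : ℝ → ℝ) (xc : ℝ),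
    IsTortoiseRadius M r xc → ∀ (s ℓ : ℕ), s ≤ 2 → s ≤ ℓ →
      ∀ ρ : ℝ, C * (1 + Real.log ((ℓ : ℝ) + 1)) ≤ ρ →
        ChannelInequality (linePotential M s ℓ r) xc ρ c

/-- `K1 → K1R` (take `C := 0`): the repaired crux is a WEAKENING of the refuted one, as intended;
the frozen-packet witnesses of p75070 need `V(x_e) ≍ ℓ² e^{−ρ/2M} → ∞`, i.e. they bite K1R only for
`C < 4M`, and K1R lets the prover choose `C`. [folklore] -/
theorem k1R_of_fixedBall (h : FixedBallChannels) : UniformPhotonSphereChannelsR := by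
  intro M hM
  obtain ⟨ρ₀, hρ₀, c, hc, H⟩ := h M hM
  refine ⟨ρ₀, hρ₀, 0, le_rfl, c, hc, fun r xc hr s ℓ hs hsℓ ρ hρ ↦ H r xc hr s ℓ hs hsℓ ρ ?_⟩
  simpa using hρ

/-- `K1R → LogBall` (take `C' := max ρ₀ C`; `ρ₀ + C log(ℓ+1) ≤ C'(1 + log(ℓ+1))`). [folklore] -/
theorem logBall_of_k1R (h : UniformPhotonSphereChannelsR) : LogBallChannels := by
  intro M hM
  obtain ⟨ρ₀, hρ₀, C, hC, c, hc, H⟩ := h M hM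
  refine ⟨max ρ₀ C, le_max_of_le_left hρ₀, c, hc, fun r xc hr s ℓ hs hsℓ ρ hρ ↦
    H r xc hr s ℓ hs hsℓ ρ ?_⟩
  have hlog : 0 ≤ Real.log ((ℓ : ℝ) + 1) := Real.log_nonneg (by simp)
  have h1 : ρ₀ ≤ max ρ₀ C := le_max_left _ _
  have h2 : C * Real.log ((ℓ : ℝ) + 1) ≤ max ρ₀ C * Real.log ((ℓ : ℝ) + 1) :=
    mul_le_mul_of_nonneg_right (le_max_right _ _) hlog
  nlinarith

/-- `LogBall → K1R` (take `ρ₀ := C`, same `C`). Hence **`K1R ↔ LogBall`**: the planner's repaired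
antecedent is exactly repair (a) anticipated by the 10046 disproof file (§4 there), whose analysis of
the witnesses (horizon beams miss it; far side = kit job j007025 of that seat) transfers verbatim. [folklore] -/
theorem k1R_of_logBall (h : LogBallChannels) : UniformPhotonSphereChannelsR := by
  intro M hM
  obtain ⟨C, hC, c, hc, H⟩ := h M hM
  refine ⟨C, hC, C, hC, c, hc, fun r xc hr s ℓ hs hsℓ ρ hρ ↦ H r xc hr s ℓ hs hsℓ ρ ?_⟩
  linarith

/-- **`K1R ↔ LogBall`.** [folklore] -/
theorem k1R_iff_logBall : UniformPhotonSphereChannelsR ↔ LogBallChannels :=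
  ⟨logBall_of_k1R, k1R_of_logBall⟩

/-- **Robustness of K2R under the equivalent antecedent**: `K2R ↔ (LogBall → Φ)`. [folklore] -/
theorem k2R_iff_logBall_imp : ChannelsResolveTameDevelopmentsR ↔ (LogBallChannels → TameResolution) :=
  ⟨fun h hL ↦ h (k1R_of_logBall hL), fun h h₁ ↦ h (logBall_of_k1R h₁)⟩

/-- `K1R → FixedModeChannels` (the route's rank-5 support item 10048: per-mode constants;
`ρ₀(M,s,ℓ) := ρ₀ + C log(ℓ+1)`, same `c`; the inlined `let`s of `FixedModeChannels` are the
Literature definitions verbatim). [folklore] -/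
theorem fixedMode_of_k1R (h : UniformPhotonSphereChannelsR) : FixedModeChannels := by
  intro M hM s ℓ hs hsℓ
  obtain ⟨ρ₀, hρ₀, C, hC, c, hc, H⟩ := h M hM
  have hlog : 0 ≤ Real.log ((ℓ : ℝ) + 1) := Real.log_nonneg (by simp)
  refine ⟨ρ₀ + C * Real.log ((ℓ : ℝ) + 1), by positivity, c, hc, ?_⟩
  intro r xc hr hr' hxc ρ hρ ψ hψ V e IsSol Ω P Eext hsol
  exact H r xc ⟨hr, hr', hxc⟩ s ℓ hs hsℓ ρ hρ ψ ⟨hψ, hsol⟩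

/-- Hence the crux with the PER-MODE antecedent is the strongest of the family:
`(FixedModeChannels → Φ) → K2R`. [folklore] -/
theorem k2R_of_fixedMode_imp (h : FixedModeChannels → TameResolution) : ChannelsResolveTameDevelopmentsR :=
  fun h₁ ↦ h (fixedMode_of_k1R h₁)

/-- **Ex-falso inheritance one rung down**: if the per-mode rung `FixedModeChannels` (item 10048,
far half unproved, "why it might fail: the true non-radiative space may exceed the t-polynomial
solutions") is false, then `K1R` is false and K2R is vacuously TRUE. [folklore] -/
theorem k2R_of_not_fixedMode (h : ¬ FixedModeChannels) : ChannelsResolveTameDevelopmentsR :=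
  k2R_of_not_k1R fun h₁ ↦ h (fixedMode_of_k1R h₁)

/-- The old crux K2 = `K1 → Φ` follows from K2R (contravariance in the antecedent); K2 is in any
case a theorem (`not_UniformPhotonSphereChannels`). [folklore] -/
theorem k2_of_k2R (h : ChannelsResolveTameDevelopmentsR) : FixedBallChannels → TameResolution :=
  fun h₁ ↦ h (k1R_of_fixedBall h₁)

/-! ## 3. What a refutation of K2R must construct -/

/-- **The witness type of `¬Φ_T2`** (re-typed, cycle 3). A tame non-settling development: a data
manifold `X`, an admissible vacuum datum `D`, a vacuum Cauchy development `𝒟` CERTIFIED MAXIMAL, with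
complete `𝓘⁺` (sojourn form), no `C²` extremal-Kerr remnant chart, `C³`-bounded outer geometry at a
uniform scale, and NO honest ray-containing exhaustive future-oriented decomposition.
`¬Φ ↔ Nonempty TameNonSettlingWitness` (`not_tameResolution_iff`); since `K1R` is proved,
`¬K2R ↔ Nonempty TameNonSettlingWitness` (`not_k2R_iff_nonempty`). On paper the known candidates are
the objects conjectured not to exist (§5: AF vacuum breather/geon, smooth non-Kerr stationary vacuum
black hole, eternal bound binary) PLUS, new with T2, the HIDDEN-BAG development of §8 (`bag_exposure`),
which is expected TO exist. In the tree NO term of this type is constructible today, for a reason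
independent of Φ's truth: the field `isMaximal` asks that every vacuum Cauchy development of `D` embed
into `𝒟` (Choquet-Bruhat–Geroch + Zorn/Sbierski), and no such certificate exists for any development of
the prelude (Minkowski included); an old-form witness (conclusion `O = exteriorOf ∧ HasExhaustiveCharts`
refuted) yields a new one (`nonSettling_of_old`). [cite: DafermosLuk2017, Conjecture 1] -/
structure TameNonSettlingWitness where
  /-- the data manifold -/
  X : Type
  [top : TopologicalSpace X]
  [charted : ChartedSpace Literature.Geometry.Lorentzian.E3 X]
  [manifold : IsManifold (modelWithCornersSelf ℝ Literature.Geometry.Lorentzian.E3) ((⊤ : ℕ∞) : WithTop ℕ∞) X]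
  [t2 : T2Space X]
  [secondCountable : SecondCountableTopology X]
  [connected : ConnectedSpace X]
  /-- the admissible datum -/
  D : Literature.Geometry.Lorentzian.InitialDataSet (modelWithCornersSelf ℝ Literature.Geometry.Lorentzian.E3) X
  admissible : D ∈ Literature.Geometry.Lorentzian.admissibleVacuumData X
  /-- the development, certified maximal -/
  dev : Literature.Geometry.Lorentzian.VacuumCauchyDevelopment D
  isMaximal : dev.IsMaximal
  complete : _root_.Summit.FinalStateConjecture.HasCompleteNullInfinity dev.toCauchyDevelopment
  noExtremalRemnant : ∀ (Λ : Literature.Geometry.Lorentzian.lorentzGroup) (c : Literature.Geometry.Lorentzian.E4) (M a : ℝ), Literature.Geometry.Lorentzian.Kerr.IsExtremal M a → ¬ ∃ (τ₀ : ℝ) (Ψ : (Literature.Geometry.Lorentzian.boostedKerrBackground Λ c M a).domain → dev.carrier), dev.toSpacetime.IsLateChart (Literature.Geometry.Lorentzian.boostedKerrBackground Λ c M a) Set.univ τ₀ Ψ ∧ ∀ R : ℝ, Filter.Tendsto (fun τ => dev.toSpacetime.truncDeviationCk (Literature.Geometry.Lorentzian.boostedKerrBackground Λ c M a) Ψ 2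 R τ) Filter.atTop (nhds 0)
  tame : ∀ [dev.metric.HasLeviCivita], let outer : Set dev.carrier := dev.metric.causalFuture dev.timeOrientation (Set.range dev.embed) ∩ {q | ∃ (p : X) (γ : ℝ → dev.carrier) (dom : Set ℝ), dev.metric.IsNormalisedNullRayFrom dev.timeOrientation dev.embed dev.normal p γ dom ∧ ¬ BddAbove dom ∧ q ∈ dev.metric.chronologicalPast dev.timeOrientation (γ '' (dom ∩ Set.Ici 0))}; ∃ r₀ : ℝ, 0 < r₀ ∧ ∃ Λ : NNReal, ∀ q ∈ outer, let U : TopologicalSpace.Opens Literature.Geometry.Lorentzian.E4 := ⟨Metric.ball (0 : Literature.Geometry.Lorentzian.E4) r₀, Metric.isOpen_ball⟩; ∃ Ψ : U → dev.carrier, dev.toSpacetime.IsLateChart (Literature.Geometry.Lorentzian.Minkowski.backgroundOn U) Set.univ (-r₀) Ψ ∧ (∃ x : U, (x : Literature.Geometry.Lorentzian.E4) = 0 ∧ Ψ x = q) ∧ Literature.Geometry.Lorentzian.supCkENorm (U : Set Literature.Geometry.Lorentzian.E4) 3 (dev.toSpacetime.deviationExtend (Literature.Geometry.Lorentzian.Minkowski.backgroundOn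 U) Ψ) ≤ (Λ : ENNReal) ∧ Literature.Geometry.Lorentzian.supCkENorm (U : Set Literature.Geometry.Lorentzian.E4) 0 (dev.toSpacetime.deviationExtend (Literature.Geometry.Lorentzian.Minkowski.backgroundOn U) Ψ) ≤ 1 / 2
  /-- non-settling (T2): no honest, ray-containing, exhaustive, future-oriented `2`-decomposition -/
  nonSettling : ¬ ∃ (O : Set dev.carrier) (d : Literature.Geometry.Lorentzian.FinalStateDecomposition dev.toSpacetime O 2), O = _root_.Summit.FinalStateConjecture.exteriorOf dev.toCauchyDevelopment d.charted ∧ _root_.Summit.FinalStateConjecture.RaysStayInClosure dev.toCauchyDevelopment O ∧ _root_.Summit.FinalStateConjecture.HasExhaustiveCharts d ∧ _root_.Summit.FinalStateConjecture.IsFutureOriented d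

/-- **`¬Φ ↔` a tame non-settling witness exists.** [folklore] -/
theorem not_tameResolution_iff : ¬ TameResolution ↔ Nonempty TameNonSettlingWitness := by
  constructor
  · intro h
    by_contra hne
    apply h
    intro X _ _ _ _ _ _ D hD 𝒟 hmax hcomp hyp
    by_contra hnot
    exact hne ⟨@TameNonSettlingWitness.mk X _ _ _ _ _ _ D hD 𝒟 hmax hcomp hyp.1 hyp.2 hnot⟩
  · rintro ⟨w⟩ hΦ
    exact w.nonSettling (@hΦ w.X w.top w.charted w.manifold w.t2 w.secondCountable w.connected
      w.D w.admissible w.dev w.isMaximal w.complete ⟨w.noExtremalRemnant, w.tame⟩)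

/-- **What a refutation of K2R is**: a proof of the log-ball channel inequality `K1R` together with a
tame non-settling witness. The first half is now in the tree (`UniformPhotonSphereChannelsR_holds`); no
witness is constructible (docstring of the structure). [folklore] -/
theorem not_k2R_iff :
    ¬ ChannelsResolveTameDevelopmentsR ↔ UniformPhotonSphereChannelsR ∧ Nonempty TameNonSettlingWitness := by
  rw [← not_tameResolution_iff]
  exact ⟨k1R_and_not_tameResolution_of_not_k2R, fun ⟨h₁, hΦ⟩ h ↦ hΦ (h h₁)⟩

/-- **`¬K2R ↔` a T2 witness exists** (cycle 3: `K1R` discharged). [folklore] -/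
theorem not_k2R_iff_nonempty : ¬ ChannelsResolveTameDevelopmentsR ↔ Nonempty TameNonSettlingWitness := by
  rw [not_k2R_iff]
  exact ⟨fun h ↦ h.2, fun h ↦ ⟨UniformPhotonSphereChannelsR_holds, h⟩⟩

/-- **An old-form witness is a new-form witness**: the rev-14 non-settling predicate implies the T2
one, for any development (a certified tame development refuting `O = exteriorOf ∧ HasExhaustiveCharts`
gives a `TameNonSettlingWitness` with `nonSettling := nonSettling_of_old dev h`). [folklore] -/
theorem nonSettling_of_old {X : Type} [TopologicalSpace X] [ChartedSpace Literature.Geometry.Lorentzian.E3 X]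
    [IsManifold (modelWithCornersSelf ℝ Literature.Geometry.Lorentzian.E3) ((⊤ : ℕ∞) : WithTop ℕ∞) X]
    [ConnectedSpace X]
    {D : Literature.Geometry.Lorentzian.InitialDataSet (modelWithCornersSelf ℝ Literature.Geometry.Lorentzian.E3) X}
    (dev : Literature.Geometry.Lorentzian.VacuumCauchyDevelopment D)
    (h : ¬ ∃ (O : Set dev.carrier) (d : Literature.Geometry.Lorentzian.FinalStateDecomposition dev.toSpacetime O 2),
      O = _root_.Summit.FinalStateConjecture.exteriorOf dev.toCauchyDevelopment d.charted ∧
        _root_.Summit.FinalStateConjecture.HasExhaustiveCharts d) :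
    ¬ ∃ (O : Set dev.carrier) (d : Literature.Geometry.Lorentzian.FinalStateDecomposition dev.toSpacetime O 2),
      O = _root_.Summit.FinalStateConjecture.exteriorOf dev.toCauchyDevelopment d.charted ∧
        _root_.Summit.FinalStateConjecture.RaysStayInClosure dev.toCauchyDevelopment O ∧
          _root_.Summit.FinalStateConjecture.HasExhaustiveCharts d ∧
            _root_.Summit.FinalStateConjecture.IsFutureOriented d := by
  rintro ⟨O, d, hO, -, hexh, -⟩
  exact h ⟨O, d, hO, hexh⟩

/-! ## 4. Load-bearing analysis of `Φ` (hypothesis mutation; defs re-typed to the T2 conclusion)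

For each hypothesis `H` of `Φ` the statement with `H` dropped is STRONGER, so `ΦWithoutH → Φ` is
trivial and recorded; the informative direction — is `ΦWithoutH` false while `Φ` is plausible? — is
decided in Lean where the flat model class decides it and ON PAPER otherwise. Summary:
(i) redundant for Φ; `IsMaximal` redundant given complete `𝓘⁺` — indeed Φ_T2 WITHOUT `IsMaximal` HOLDS
on the whole certifiable class (`Negative/SubMinkowskiSettledT2.settlesT2_of_hasCompleteNullInfinity`,
session 22 of the 14075 disprover: every sojourn-complete open sub-development `η|_U` of the trivial
datum carries the honest `N = 0` decomposition with ray closure and orientation); {`IsMaximal`, complete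
`𝓘⁺`} JOINTLY load-bearing — KERNEL-CHECKED: `not_tameResolutionAllDevelopments` below (slab witness of
`Negative/SlabMinkowskiLoadBearing`, transported to the T2 body by monotonicity); (ii) load-bearing on
paper (and, §8.2, weaker than it looks: Lorentz-pancake-blind). -/

/-- **Φ without (i)** (no extremal-remnant clause dropped). ON PAPER NOT LOAD-BEARING for Φ: the
conclusion's `FinalStateDecomposition` only asks `|aᵢ| ≤ Mᵢ` (`abs_spin_le_mass`), so a development
settling smoothly (in `C²` up to the horizon) to an exactly extremal Kerr satisfies the conclusion
with an extremal hole chart; the only developments removed by (i) and not already by (ii) would be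
ROUGH extremal ω-limits, but transversal (Aretakis/Lucietti–Reall) growth along a degenerate horizon
lies inside the closed coordinate balls of radius `r₀` centred at near-horizon outer points, so it
violates the `C³` bound of (ii) as well. (i) earns its place only in the Assembly (`closes` derives
`|aᵢ| < Mᵢ` from it). Vacuum extremal-Kerr formation is itself conjectural (Kehle–Unger,
arXiv:2402.10190, is Einstein–Maxwell–charged scalar field). [cite: arXiv:2402.10190, §1] -/
def TameResolutionWithoutExtremalClause : Prop :=
  ∀ (X : Type) [TopologicalSpace X] [ChartedSpace Literature.Geometry.Lorentzian.E3 X] [IsManifold (modelWithCornersSelf ℝ Literature.Geometry.Lorentzian.E3) ((⊤ : ℕ∞) : WithTop ℕ∞) X] [T2Space X] [SecondCountableTopology X] [ConnectedSpace X], ∀ D ∈ Literature.Geometry.Lorentzian.admissibleVacuumData X, ∀ 𝒟 : Literature.Geometry.Lorentzian.VacuumCauchyDevelopment D, 𝒟.IsMaximal → _root_.Summit.FinalStateConjecture.HasCompleteNullInfinity 𝒟.toCauchyDevelopment → (∀ [𝒟.metric.HasLeviCivita], let outer : Set 𝒟.carrier := 𝒟.metric.causalFuture 𝒟.timeOrientation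 (Set.range 𝒟.embed) ∩ {q | ∃ (p : X) (γ : ℝ → 𝒟.carrier) (dom : Set ℝ), 𝒟.metric.IsNormalisedNullRayFrom 𝒟.timeOrientation 𝒟.embed 𝒟.normal p γ dom ∧ ¬ BddAbove dom ∧ q ∈ 𝒟.metric.chronologicalPast 𝒟.timeOrientation (γ '' (dom ∩ Set.Ici 0))}; ∃ r₀ : ℝ, 0 < r₀ ∧ ∃ Λ : NNReal, ∀ q ∈ outer, let U : TopologicalSpace.Opens Literature.Geometry.Lorentzian.E4 := ⟨Metric.ball (0 : Literature.Geometry.Lorentzian.E4) r₀, Metric.isOpen_ball⟩; ∃ Ψ : U → 𝒟.carrier, 𝒟.toSpacetime.IsLateChart (Literature.Geometry.Lorentzian.Minkowski.backgroundOn U) Set.univ (-r₀) Ψ ∧ (∃ x : U, (x : Literature.Geometry.Lorentzian.E4) = 0 ∧ Ψ x = q) ∧ Literature.Geometry.Lorentzian.supCkENorm (U : Set Literature.Geometry.Lorentzian.E4) 3 (𝒟.toSpacetime.deviationExtend (Literature.Geometry.Lorentzian.Minkowski.backgroundOn U) Ψ) ≤ (Λ : ENNReal) ∧ Literature.Geometry.Lorentzian.supCkENorm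 (U : Set Literature.Geometry.Lorentzian.E4) 0 (𝒟.toSpacetime.deviationExtend (Literature.Geometry.Lorentzian.Minkowski.backgroundOn U) Ψ) ≤ 1 / 2) → ∃ (O : Set 𝒟.carrier) (d : Literature.Geometry.Lorentzian.FinalStateDecomposition 𝒟.toSpacetime O 2), O = _root_.Summit.FinalStateConjecture.exteriorOf 𝒟.toCauchyDevelopment d.charted ∧ _root_.Summit.FinalStateConjecture.RaysStayInClosure 𝒟.toCauchyDevelopment O ∧ _root_.Summit.FinalStateConjecture.HasExhaustiveCharts d ∧ _root_.Summit.FinalStateConjecture.IsFutureOriented d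

/-- Dropping (i) strengthens Φ (trivial direction). [folklore] -/
theorem tameResolution_of_withoutExtremalClause (h : TameResolutionWithoutExtremalClause) :
    TameResolution :=
  fun X _ _ _ _ _ _ D hD 𝒟 hmax hcomp hyp ↦ h X D hD 𝒟 hmax hcomp hyp.2

/-- **Φ without `IsMaximal`** (asserted for EVERY vacuum Cauchy development, not only MGHDs). ON
PAPER MORALLY REDUNDANT GIVEN COMPLETE `𝓘⁺`: if `𝒟' ⊊ 𝒟` omits a future set `F` of the MGHD and
`x ∈ F` is visible from infinity (`x ∈ J⁻(𝓘⁺)`), then `F ⊇ J⁺(x)` (else `ι(X)` is not Cauchy for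
`𝒟'`), and the normalised null ray from a far point `p ∈ Σ`, `|p| = R`, aimed at `x` enters `J⁺(x)`
at affine time `≈ (R + t_x)/2` after entering `J⁺(ι B₀)` at `≈ (R − R₀)/2`: its sojourn is
`≲ (t_x + |x| + R₀)/2`, bounded in `R`, so the sojourn form of completeness FAILS for `𝒟'` (this is
the "time-truncated Minkowski ✗" column of `NullInfinity.lean`, made quantitative). Hence a complete
`𝒟'` contains the whole visible future of its MGHD, and Φ's conclusion for the MGHD restricts to `𝒟'`
(future sets hidden inside black holes are invisible to `exteriorOf`/`HasExhaustiveCharts`). So no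
cheap counterexample to this strengthening exists either. [cite: arXiv08110354, §2.6.2] -/
def TameResolutionWithoutMaximal : Prop :=
  ∀ (X : Type) [TopologicalSpace X] [ChartedSpace Literature.Geometry.Lorentzian.E3 X] [IsManifold (modelWithCornersSelf ℝ Literature.Geometry.Lorentzian.E3) ((⊤ : ℕ∞) : WithTop ℕ∞) X] [T2Space X] [SecondCountableTopology X] [ConnectedSpace X], ∀ D ∈ Literature.Geometry.Lorentzian.admissibleVacuumData X, ∀ 𝒟 : Literature.Geometry.Lorentzian.VacuumCauchyDevelopment D, _root_.Summit.FinalStateConjecture.HasCompleteNullInfinity 𝒟.toCauchyDevelopment → ((∀ (Λ : Literature.Geometry.Lorentzian.lorentzGroup) (c : Literature.Geometry.Lorentzian.E4) (M a : ℝ), Literature.Geometry.Lorentzian.Kerr.IsExtremal M a → ¬ ∃ (τ₀ : ℝ) (Ψ : (Literature.Geometry.Lorentzian.boostedKerrBackground Λ c M a).domain → 𝒟.carrier), 𝒟.toSpacetime.IsLateChart (Literature.Geometry.Lorentzian.boostedKerrBackground Λ c M a) Set.univ τ₀ Ψ ∧ ∀ R : ℝ, Filter.Tendsto (fun τ =>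 𝒟.toSpacetime.truncDeviationCk (Literature.Geometry.Lorentzian.boostedKerrBackground Λ c M a) Ψ 2 R τ) Filter.atTop (nhds 0)) ∧ ∀ [𝒟.metric.HasLeviCivita], let outer : Set 𝒟.carrier := 𝒟.metric.causalFuture 𝒟.timeOrientation (Set.range 𝒟.embed) ∩ {q | ∃ (p : X) (γ : ℝ → 𝒟.carrier) (dom : Set ℝ), 𝒟.metric.IsNormalisedNullRayFrom 𝒟.timeOrientation 𝒟.embed 𝒟.normal p γ dom ∧ ¬ BddAbove dom ∧ q ∈ 𝒟.metric.chronologicalPast 𝒟.timeOrientation (γ '' (dom ∩ Set.Ici 0))}; ∃ r₀ : ℝ, 0 < r₀ ∧ ∃ Λ : NNReal, ∀ q ∈ outer, let U : TopologicalSpace.Opens Literature.Geometry.Lorentzian.E4 := ⟨Metric.ball (0 : Literature.Geometry.Lorentzian.E4) r₀, Metric.isOpen_ball⟩; ∃ Ψ : U → 𝒟.carrier, 𝒟.toSpacetime.IsLateChart (Literature.Geometry.Lorentzian.Minkowski.backgroundOn U) Set.univ (-r₀) Ψ ∧ (∃ x : U, (x : Literature.Geometry.Lorentzian.E4) = 0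 ∧ Ψ x = q) ∧ Literature.Geometry.Lorentzian.supCkENorm (U : Set Literature.Geometry.Lorentzian.E4) 3 (𝒟.toSpacetime.deviationExtend (Literature.Geometry.Lorentzian.Minkowski.backgroundOn U) Ψ) ≤ (Λ : ENNReal) ∧ Literature.Geometry.Lorentzian.supCkENorm (U : Set Literature.Geometry.Lorentzian.E4) 0 (𝒟.toSpacetime.deviationExtend (Literature.Geometry.Lorentzian.Minkowski.backgroundOn U) Ψ) ≤ 1 / 2) → ∃ (O : Set 𝒟.carrier) (d : Literature.Geometry.Lorentzian.FinalStateDecomposition 𝒟.toSpacetime O 2), O = _root_.Summit.FinalStateConjecture.exteriorOf 𝒟.toCauchyDevelopment d.charted ∧ _root_.Summit.FinalStateConjecture.RaysStayInClosure 𝒟.toCauchyDevelopment O ∧ _root_.Summit.FinalStateConjecture.HasExhaustiveCharts d ∧ _root_.Summit.FinalStateConjecture.IsFutureOriented d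

/-- Dropping `IsMaximal` strengthens Φ (trivial direction). [folklore] -/
theorem tameResolution_of_withoutMaximal (h : TameResolutionWithoutMaximal) : TameResolution :=
  fun X _ _ _ _ _ _ D hD 𝒟 _ hcomp hyp ↦ h X D hD 𝒟 hcomp hyp

/-- **Φ without `IsMaximal` AND without complete `𝓘⁺`.** ON PAPER FALSE — the pair is jointly
load-bearing. Witness: time-truncated Minkowski `𝒟_T = {t < T} ⊂ ℝ^{1+3}`, a vacuum Cauchy
development of the trivial datum (`{t = 0}` is met once by every timelike curve endless in `𝒟_T`):
(i) holds (a `C²`-converging extremal chart would make curvature ≈ Kerr's ≠ 0 inside flat space);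
(ii) holds (flat balls). But no `FinalStateDecomposition` exists: with `N = 0` the flat chart `Ψ₀`
is an open embedding of the whole late half-space `{x⁰ > τ₀}` into `O ⊆ J⁺(Σ) = {0 ≤ t < T}` with
`Ψ₀^*η → η` in `C⁰` along the slabs, so for large `τ₁` the `x⁰`-line `s ↦ Ψ₀(s, y)`, `s ≥ τ₁`, is
timelike with `η(∂ₛ, ∂ₛ) ≤ −1/2`, hence `|d(t ∘ Ψ₀)/ds| ≥ 1/√2` of constant sign, and `t ∘ Ψ₀` leaves
`[0, T)` — contradiction; `N ≥ 1` needs near-Kerr regions (curvature). The same argument shows that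
any development satisfying Φ's conclusion contains timelike curves of infinite length in `J⁺(Σ)`.
Truncated Minkowski fails BOTH dropped hypotheses (sojourn `≤ T`; not maximal), which is why neither
`TameResolutionWithoutMaximal` nor "Φ without completeness" is hit by it.
[cite: ChristodoulouKlainerman1993, Thm. 1.0.2] -/
def TameResolutionAllDevelopments : Prop :=
  ∀ (X : Type) [TopologicalSpace X] [ChartedSpace Literature.Geometry.Lorentzian.E3 X] [IsManifold (modelWithCornersSelf ℝ Literature.Geometry.Lorentzian.E3) ((⊤ : ℕ∞) : WithTop ℕ∞) X] [T2Space X] [SecondCountableTopology X] [ConnectedSpace X], ∀ D ∈ Literature.Geometry.Lorentzian.admissibleVacuumData X, ∀ 𝒟 : Literature.Geometry.Lorentzian.VacuumCauchyDevelopment D, ((∀ (Λ : Literature.Geometry.Lorentzian.lorentzGroup) (c : Literature.Geometry.Lorentzian.E4) (M a : ℝ), Literature.Geometry.Lorentzian.Kerr.IsExtremal M a → ¬ ∃ (τ₀ : ℝ) (Ψ : (Literature.Geometry.Lorentzian.boostedKerrBackground Λ c M a).domain → 𝒟.carrier), 𝒟.toSpacetime.IsLateChart (Literature.Geometry.Lorentzian.boostedKerrBackground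 Λ c M a) Set.univ τ₀ Ψ ∧ ∀ R : ℝ, Filter.Tendsto (fun τ => 𝒟.toSpacetime.truncDeviationCk (Literature.Geometry.Lorentzian.boostedKerrBackground Λ c M a) Ψ 2 R τ) Filter.atTop (nhds 0)) ∧ ∀ [𝒟.metric.HasLeviCivita], let outer : Set 𝒟.carrier := 𝒟.metric.causalFuture 𝒟.timeOrientation (Set.range 𝒟.embed) ∩ {q | ∃ (p : X) (γ : ℝ → 𝒟.carrier) (dom : Set ℝ), 𝒟.metric.IsNormalisedNullRayFrom 𝒟.timeOrientation 𝒟.embed 𝒟.normal p γ dom ∧ ¬ BddAbove dom ∧ q ∈ 𝒟.metric.chronologicalPast 𝒟.timeOrientation (γ '' (dom ∩ Set.Ici 0))}; ∃ r₀ : ℝ, 0 < r₀ ∧ ∃ Λ : NNReal, ∀ q ∈ outer, let U : TopologicalSpace.Opens Literature.Geometry.Lorentzian.E4 := ⟨Metric.ball (0 : Literature.Geometry.Lorentzian.E4) r₀, Metric.isOpen_ball⟩; ∃ Ψ : U → 𝒟.carrier, 𝒟.toSpacetime.IsLateChart (Literature.Geometry.Lorentzian.Minkowski.backgroundOn U)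 Set.univ (-r₀) Ψ ∧ (∃ x : U, (x : Literature.Geometry.Lorentzian.E4) = 0 ∧ Ψ x = q) ∧ Literature.Geometry.Lorentzian.supCkENorm (U : Set Literature.Geometry.Lorentzian.E4) 3 (𝒟.toSpacetime.deviationExtend (Literature.Geometry.Lorentzian.Minkowski.backgroundOn U) Ψ) ≤ (Λ : ENNReal) ∧ Literature.Geometry.Lorentzian.supCkENorm (U : Set Literature.Geometry.Lorentzian.E4) 0 (𝒟.toSpacetime.deviationExtend (Literature.Geometry.Lorentzian.Minkowski.backgroundOn U) Ψ) ≤ 1 / 2) → ∃ (O : Set 𝒟.carrier) (d : Literature.Geometry.Lorentzian.FinalStateDecomposition 𝒟.toSpacetime O 2), O = _root_.Summit.FinalStateConjecture.exteriorOf 𝒟.toCauchyDevelopment d.charted ∧ _root_.Summit.FinalStateConjecture.RaysStayInClosure 𝒟.toCauchyDevelopment O ∧ _root_.Summit.FinalStateConjecture.HasExhaustiveCharts d ∧ _root_.Summit.FinalStateConjecture.IsFutureOriented d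

/-- The doubly-mutated statement implies the singly-mutated one (trivial direction). [folklore] -/
theorem withoutMaximal_of_allDevelopments (h : TameResolutionAllDevelopments) :
    TameResolutionWithoutMaximal :=
  fun X _ _ _ _ _ _ D hD 𝒟 _ hyp ↦ h X D hD 𝒟 hyp

/-- **`Φ_T2` WITHOUT `IsMaximal` AND WITHOUT complete `𝓘⁺` IS FALSE** (the `_false_without_` theorem of
this file; category (a) of the protocol). Witness: the time slab `{-1 < x⁰ < 1}` of Minkowski space over
the trivial admissible datum — LANDED as `Negative.not_tameResolution_allDevelopments`
(`Theorems/ChannelsResolveTameDevelopmentsR/Negative/SlabMinkowskiLoadBearing.lean`, 14075 disprover,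
sessions 16–21: admissible, (i) no hole chart at all, (ii) outer region empty, and NO
`FinalStateDecomposition` of any region since every late chart carries a uniformly timelike coordinate
line of unbounded chart time). That theorem refutes the rev-14 body; the T2 body implies it conjunct by
conjunct, so it falls too. Hence any proof of Φ_T2 must use maximality or completeness of the
development ESSENTIALLY (e.g. through exterior stability near `i⁰` / existence of the radiation zone);
a line whose stubs consume only (i), (ii) and `Ric = 0` is refuted by the slab. [folklore] -/
theorem not_tameResolutionAllDevelopments : ¬ TameResolutionAllDevelopments := by
  intro h
  refine Summit.FinalStateConjecture.FinalStateConjecture.Theorems.ChannelsResolveTameDevelopmentsR.Negative.not_tameResolution_allDevelopments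
    ?_
  intro X _ _ _ _ _ _ D hD 𝒟 hyp
  obtain ⟨O, d, hO, -, hexh, -⟩ := h X D hD 𝒟 hyp
  exact ⟨O, d, hO, hexh⟩

/-- Restatement in `_false_without_` naming: the pair {`IsMaximal`, complete `𝓘⁺`} is load-bearing. [folklore] -/
theorem tameResolution_false_without_maximal_and_complete : ¬ TameResolutionAllDevelopments :=
  not_tameResolutionAllDevelopments

/-- **Φ without (ii)** (tameness dropped: complete `𝓘⁺` + maximal + no extremal remnant ⇒ settles).
ON PAPER (ii) IS LOAD-BEARING but no refutation of this strengthening is in print either: the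
developments it alone removes are (a) complete-`𝓘⁺` exteriors with unbounded late-time curvature in
`J⁻(𝓘⁺)` (no example known; a-priori tameness is precisely what the stability proofs propagate),
(b) rough approach to an extremal horizon (vacuum: conjectural), (c) naked singularities — but those
have INCOMPLETE `𝓘⁺` (Rodnianski–Shlapentokh-Rothman) and are removed twice. Recorded so that
provers know tameness may be USED essentially (compactness of pointed `C³`-bounded vacuum regions,
Cheeger–Gromov/Anderson), not merely carried. [cite: DafermosLuk2017, §1.2.1] -/
def TameResolutionWithoutTameness : Prop :=
  ∀ (X : Type) [TopologicalSpace X] [ChartedSpace Literature.Geometry.Lorentzian.E3 X] [IsManifold (modelWithCornersSelf ℝ Literature.Geometry.Lorentzian.E3) ((⊤ : ℕ∞) : WithTop ℕ∞) X] [T2Space X] [SecondCountableTopology X] [ConnectedSpace X], ∀ D ∈ Literature.Geometry.Lorentzian.admissibleVacuumData X, ∀ 𝒟 : Literature.Geometry.Lorentzian.VacuumCauchyDevelopment D, 𝒟.IsMaximal → _root_.Summit.FinalStateConjecture.HasCompleteNullInfinity 𝒟.toCauchyDevelopment → (∀ (Λ : Literature.Geometry.Lorentzian.lorentzGroup) (c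 : Literature.Geometry.Lorentzian.E4) (M a : ℝ), Literature.Geometry.Lorentzian.Kerr.IsExtremal M a → ¬ ∃ (τ₀ : ℝ) (Ψ : (Literature.Geometry.Lorentzian.boostedKerrBackground Λ c M a).domain → 𝒟.carrier), 𝒟.toSpacetime.IsLateChart (Literature.Geometry.Lorentzian.boostedKerrBackground Λ c M a) Set.univ τ₀ Ψ ∧ ∀ R : ℝ, Filter.Tendsto (fun τ => 𝒟.toSpacetime.truncDeviationCk (Literature.Geometry.Lorentzian.boostedKerrBackground Λ c M a) Ψ 2 R τ) Filter.atTop (nhds 0)) → ∃ (O : Set 𝒟.carrier) (d : Literature.Geometry.Lorentzian.FinalStateDecomposition 𝒟.toSpacetime O 2), O = _root_.Summit.FinalStateConjecture.exteriorOf 𝒟.toCauchyDevelopment d.charted ∧ _root_.Summit.FinalStateConjecture.RaysStayInClosure 𝒟.toCauchyDevelopment O ∧ _root_.Summit.FinalStateConjecture.HasExhaustiveCharts d ∧ _root_.Summit.FinalStateConjecture.IsFutureOriented d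

/-- Dropping (ii) strengthens Φ (trivial direction). [folklore] -/
theorem tameResolution_of_withoutTameness (h : TameResolutionWithoutTameness) : TameResolution :=
  fun X _ _ _ _ _ _ D hD 𝒟 hmax hcomp hyp ↦ h X D hD 𝒟 hmax hcomp hyp.1

/-! ## 5. `Φ` itself — why it resists (candidate counterexamples and their status)

Recorded as the docstring of `tameResolution_resists` (a `True` placeholder so that the census is
attached to a declaration and survives compaction of prose). -/

/-- **Why Φ resists disproof (cycle 1 census).** A counterexample is an admissible datum (smooth,
complete, ONE AF end, `h = (1 + 2M/r)δ + o₂(r⁻¹)`, `k = o₁(r⁻²)`, vacuum constraints) whose MGHD is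
complete, tame, without `C²` extremal remnant, and does NOT settle to boosted sub/extremal Kerrs +
radiation in the chart sense. Classes examined:
* (B) AF vacuum BREATHERS / time-periodic non-stationary solutions with complete `𝓘±`: excluded only
  conditionally — Papapetrou (non-radiative + stationary near `i⁰`/analytic), Gibbons–Stewart 1984
  (periodic and empty near infinity ⇒ absent, via Bondi mass loss; needs a smooth/analytic `𝓘`),
  Bičák–Scholtz–Tod, CQG 27 (2010) 055007 (periodic ⇒ stationary near `𝓘`, analytic at `𝓘`),
  Alexakis–Schlue, JDG 108 (2018) = arXiv:1504.04592, Thm 1.1/1.2 (time-periodic near `𝓘⁺_{u₀} ∪ 𝓘⁻_{v₀}`,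
  data Kerr to leading order ⇒ stationary on a neighbourhood `D(v₀,u₀)` of those portions of `𝓘±`
  ONLY; p. 4, Remark: extending the Killing field to the interior "is a formidable challenge in full
  generality, due to the possibility of trapped null geodesics [AIK10a]" — the catalogued
  `KillingExtensionObstruction`), Thm 1.3 (non-radiating + smooth expansions at `𝓘±` ⇒ stationary
  near infinity). None known to exist; none excluded globally.
* (U) smooth NON-KERR STATIONARY vacuum black holes with non-degenerate horizon: uniqueness is known
  only for analytic exteriors (Hawking–Carter–Robinson, Chruściel–Costa) or near Kerr
  (Alexakis–Ionescu–Klainerman 2010; Ionescu–Klainerman 2009); a smooth counterexample realised inside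
  a one-ended collapse would refute Φ (cf. Kehle–Unger, Adv. Math. 2024 = arXiv:2304.08455, Cor. 1:
  one-ended AF data on `ℝ³`, of regularity `H^{7/2−} × H^{5/2−}` only, whose MGHD's domain of outer
  communication is ISOMETRIC to Kerr `(M, a)`, `|a| ≪ M`, for late advanced time — such developments
  SATISFY Φ's conclusion with `N = 1`; smooth admissible analogues are expected, not printed).
* (D) horizonless non-dispersing tame lumps (vacuum geons): large-data dispersal is open; small data
  disperse (Christodoulou–Klainerman), so no perturbative witness.
* (E) eternal bound binaries / non-separating holes: excluded by radiation-reaction folklore only.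
* (∞) infinitely many holes / arbitrarily late far-out collapse: EXCLUDED heuristically by
  admissibility — forming a hole of mass `m` from radiation at radius `R` needs energy `m` within
  radial width `≲ m`, i.e. `|∂h| ≳ R⁻¹(m/λ)^{1/2}`, `|∂²h| ≳ 1/(Rm)`, incompatible with
  `∂h = o(R⁻²)`, `∂²h = o(R⁻³)` along `R → ∞`; so `N < ∞` and collapse is confined to a bounded
  region, consistent with Φ.
* (X) exotic `X` (`K3 # ℝ³`, …; non-CMC vacuum data exist by Witt/Isenberg–Mazzeo–Pollack): only
  forces `N ≥ 1` behind horizons (topological censorship); no handle on Φ.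
* (K) the tree's Kerr target is honest: `Kerr.bilin = η + (2Mr³/(r⁴ + a²z²)) ℓ ⊗ ℓ` with Visser's `ℓ`
  (checked term by term), so exact Kerr exteriors are admissible limits.
Conclusion: Φ ⊇ (zero-news ⇒ stationary) ∘ (stationary ⇒ Kerr) on the tame locus; both steps are
open in both directions, so Φ is neither refutable from print nor from junk, and K2R a fortiori
(§3). The ONE cheap event that changes K2R's status is a refutation of K1R on its far side
(`k2R_of_not_k1R`: K2R then closes `proved`, ex falso). [cite: arXiv:1504.04592, Thm. 1.1] -/
theorem tameResolution_resists : True := trivial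

/-! ## 6. Targets and near-misses

`-- Targets`: none (payload `targets = []`; no skeleton registered under 14075 at 03:30Z nor at
04:40Z 2026-08-16; four round-1 idea cards exist, pre-screened in §7). When the lead re-registers the 10046 line `tame-hull-exact-rigidity-only` (PICKED.md of
the old crux) its closing theorem must conclude `ChannelsResolveTameDevelopmentsR` by
`k2R_of_tameResolution`; its stub C is already known false as typed (drefute g2, `|a| < M ↦ |a| ≤ M`).
No `sorry` in this file. -/

/-! ## 7. Cycle 2 (2026-08-16): pre-screen of the crux-ideate first lemmas; one-time silence is
not rigid (LANDED: `Theorems/ChannelsResolveTameDevelopmentsR/Negative/SilenceCalculus.lean`, p81766);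
collapse of two-sided hypotheses on the time-symmetric class; aperture monotonicity -/

/-! ### 7.1 The four first lemmas, as read from the cards (`Ideas/*.md`, round 1) -/

/-- **L1 = `SilentModesAreStatic`** (card `kerr-isolation-dichotomy`, ideator 1), transcribed from
the card text over the landed vocabulary: per mode, the channel inequality for all apertures
`ρ ≥ ρ₀` + two-sided bounded energy + silence at EVERY base time `t₀` through every channel of
aperture `ρ ≥ ρ₀` ⇒ static.  PRE-SCREEN (cycle 2): no cheap kill — true on paper by 1+1 short-range
scattering (asymptotic completeness for `V_{s,ℓ} ≥ 0`, `V ∈ L¹`, no bound state, no zero resonance: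
silence at every base time kills both scattering profiles, hence the energy, hence `ψ`; "static"
is then trivially true, the honest conclusion is `ψ = 0`, i.e. L4).  The channel-inequality
hypothesis is NOT needed for truth (only for the card's proof route through the kernel); the
`∀ t₀` IS load-bearing (`not_oneTimeSilenceStatic`, §7.2); `∀ ρ ≥ ρ₀` is equivalent to `ρ = ρ₀`
(`silentFrom_iff_silentAt`, §7.4). [folklore] -/
def SilentModesAreStatic : Prop :=
  ∀ M : ℝ, 0 < M → ∀ (r : ℝ → ℝ) (xc : ℝ), IsTortoiseRadius M r xc → ∀ (s ℓ : ℕ), s ≤ 2 → s ≤ ℓ →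
    ∀ (ρ₀ c : ℝ), 0 < c → (∀ ρ, ρ₀ ≤ ρ → ChannelInequality (linePotential M s ℓ r) xc ρ c) →
    ∀ ψ : ℝ → ℝ → ℝ, IsRWSolution M s ℓ r ψ →
      (∃ E : ℝ≥0∞, E ≠ ⊤ ∧ ∀ t, totalEnergy (linePotential M s ℓ r) ψ t ≤ E) →
      (∀ t₀ ρ, ρ₀ ≤ ρ →
        channelEnergy (linePotential M s ℓ r) xc ρ (fun t x ↦ ψ (t₀ + t) x) atTop = 0 ∧
        channelEnergy (linePotential M s ℓ r) xc ρ (fun t x ↦ ψ (t₀ + t) x) atBot = 0) →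
      ∀ t x, ψ t x = ψ 0 x

/-- **L4 = `EternalSilentWavesVanish`** (card `isolated-kerr-connected-hull`, ideator 2),
transcribed: a finite-energy global `C²` Regge–Wheeler solution silent at EVERY centre `T` through
every channel of aperture `ρ ≥ ρ₀ ≥ 0`, both time directions, vanishes.  PRE-SCREEN: no cheap
kill (true on paper by the scattering argument recorded under L1; M-sized analysis, nothing in the
tree yet); `∀ T` load-bearing (`not_oneTimeSilenceZero`); finite energy matters on paper only
through the exclusion of non-`L²` profiles (every non-zero STATIC solution has infinite channel
energy on at least one side — `u'' = Vu`, `V > 0` has no bounded global solution — so statics are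
not even silent).  On paper the BACKWARD (`atBot`) clause is redundant as well: forward silence at
all centres already forces the outgoing profiles `F'` on `(xc − T, ∞)` and `G'` on `(−∞, xc + T)`
to vanish for every `T`, hence zero asymptotic energy, hence `ψ = 0` by asymptotic completeness
(inverse-square far tail is Enss-short-range; no zero resonance since `V > 0`) — not provable
cheaply, recorded for the lead. [folklore] -/
def EternalSilentWavesVanish : Prop :=
  ∀ M : ℝ, 0 < M → ∀ (r : ℝ → ℝ) (xc : ℝ), IsTortoiseRadius M r xc → ∀ (s ℓ : ℕ), s ≤ 2 → s ≤ ℓ →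
    ∀ ρ₀ : ℝ, 0 ≤ ρ₀ → ∀ ψ : ℝ → ℝ → ℝ, IsRWSolution M s ℓ r ψ →
      totalEnergy (linePotential M s ℓ r) ψ 0 < ⊤ →
      (∀ T ρ, ρ₀ ≤ ρ →
        channelEnergy (linePotential M s ℓ r) xc ρ (fun t x ↦ ψ (T + t) x) atTop = 0 ∧
        channelEnergy (linePotential M s ℓ r) xc ρ (fun t x ↦ ψ (T + t) x) atBot = 0) →
      ∀ t x, ψ t x = 0

/-- **L2 = `TwoSidedTrappingTime`** (card `trapped-set-observability-analyticity`, ideator 3),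
transcribed: if a non-trivial finite-energy mode is `(1 − δ)`-concentrated in the FIXED ball
`|x − xc| ≤ ρ` at time `+T` and at time `−T`, then `T ≤ C(M,ρ)·(1 + log(ℓ+1))`.  PRE-SCREEN: no
cheap kill.  Free model (`V = 0`, d'Alembert, energy density `2F'(x−t)² + 2G'(x+t)²` pointwise
additive): for `T > ρ` the two concentration hypotheses force `a + c ≥ (1−δ)E`, `b + d ≥ (1−δ)E`
with `a + b ≤ E_F`, `c + d ≤ E_G`, hence `δ ≥ 1/2` — so for `δ < 1/2` the hypotheses are
UNSATISFIABLE beyond `T = ρ` and the bound holds with `C = ρ`; with the barrier, the only two-sided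
long-lived states are the hyperbolic barrier-top packets (`T ≈ (2ν)⁻¹ log ℓ`, `ν → 1/(3√3 M)`,
the ideator's kit j011743 slope 2.44–2.58 ≈ 3√3/2); low-frequency/plateau data dephase in `O_M(1)`
(`∂ₓ√V/√V` is `ℓ`-independent); truncated statics give `δ = O(1)` only.  `δ` existential is
load-bearing (two packets focused at `∓T` give `δ = 1/2` for every `T`, card's own remark).  On the
TIME-SYMMETRIC class the two hypotheses coincide (`twoSided_hypotheses_coincide_of_even`, §7.3):
there L2 is a ONE-time statement. [folklore] -/
def TwoSidedTrappingTime : Prop :=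
  ∀ M : ℝ, 0 < M → ∀ ρ : ℝ, 0 < ρ → ∃ δ : ℝ, 0 < δ ∧ ∃ C : ℝ, 0 ≤ C ∧
    ∀ (r : ℝ → ℝ) (xc : ℝ), IsTortoiseRadius M r xc → ∀ (s ℓ : ℕ), s ≤ 2 → s ≤ ℓ →
      ∀ ψ : ℝ → ℝ → ℝ, IsRWSolution M s ℓ r ψ →
        totalEnergy (linePotential M s ℓ r) ψ 0 ≠ ⊤ → totalEnergy (linePotential M s ℓ r) ψ 0 ≠ 0 →
        ∀ T : ℝ, 0 ≤ T →
          exteriorEnergy (linePotential M s ℓ r) xc ρ (fun t x ↦ ψ (T + t) x) 0 ≤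
            ENNReal.ofReal δ * totalEnergy (linePotential M s ℓ r) ψ T →
          exteriorEnergy (linePotential M s ℓ r) xc ρ (fun t x ↦ ψ (-T + t) x) 0 ≤
            ENNReal.ofReal δ * totalEnergy (linePotential M s ℓ r) ψ (-T) →
          T ≤ C * (1 + Real.log ((ℓ : ℝ) + 1))

/-- **L4 ⇒ L1** (zero is static; L1's bounded-energy hypothesis gives finite energy at `t = 0`,
and its silence hypothesis from `ρ₀` gives silence from `max ρ₀ 0 ≥ 0`).  So the channel
inequality in L1 is decoration as far as TRUTH is concerned — it is a proof device. [folklore] -/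
theorem silentModesAreStatic_of_eternalSilentWavesVanish (h : EternalSilentWavesVanish) :
    SilentModesAreStatic := by
  intro M hM r xc hr s ℓ hs hsℓ ρ₀ c _ _ ψ hψ hE hsil t x
  obtain ⟨E, hEtop, hEle⟩ := hE
  have hfin : totalEnergy (linePotential M s ℓ r) ψ 0 < ⊤ :=
    lt_of_le_of_lt (hEle 0) (lt_top_iff_ne_top.2 hEtop)
  have hsil' : ∀ T ρ, max ρ₀ 0 ≤ ρ →
      channelEnergy (linePotential M s ℓ r) xc ρ (fun t x ↦ ψ (T + t) x) atTop = 0 ∧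
      channelEnergy (linePotential M s ℓ r) xc ρ (fun t x ↦ ψ (T + t) x) atBot = 0 :=
    fun T ρ hρ ↦ hsil T ρ ((le_max_left _ _).trans hρ)
  have hzero := h M hM r xc hr s ℓ hs hsℓ (max ρ₀ 0) (le_max_right _ _) ψ hψ hfin hsil'
  rw [hzero t x, hzero 0 x]

/-! ### 7.2 One-time silence is not rigid (explicit small model; landed under `Negative/`) -/

/-- Vanishing on a closed cone kills the energy density on every strictly smaller open cone.
(Copy of `Negative.SilenceCalculus.energyDensity_eq_zero_of_vanish` (p81766), kept so that this
work file stays self-contained; lines should import the Negative module instead.) [folklore] -/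
theorem energyDensity_eq_zero_of_vanish (V : ℝ → ℝ) {ψ : ℝ → ℝ → ℝ} {xc a b : ℝ} (hab : a < b)
    (hzero : ∀ τ y, a + |τ| ≤ |y - xc| → ψ τ y = 0) {t x : ℝ} (hx : b + |t| < |x - xc|) :
    energyDensity V ψ t x = 0 := by
  have ht : (fun τ ↦ ψ τ x) =ᶠ[𝓝 t] fun _ ↦ (0 : ℝ) := by
    have hopen : IsOpen {τ : ℝ | a + |τ| < |x - xc|} :=
      isOpen_lt (continuous_const.add continuous_abs) continuous_const
    have hmem : t ∈ {τ : ℝ | a + |τ| < |x - xc|} := by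
      show a + |t| < |x - xc|
      linarith
    filter_upwards [hopen.mem_nhds hmem] with τ hτ
    exact hzero τ x (le_of_lt hτ)
  have hxs : (fun y ↦ ψ t y) =ᶠ[𝓝 x] fun _ ↦ (0 : ℝ) := by
    have hopen : IsOpen {y : ℝ | a + |t| < |y - xc|} :=
      isOpen_lt continuous_const ((continuous_id.sub continuous_const).abs)
    have hmem : x ∈ {y : ℝ | a + |t| < |y - xc|} := by
      show a + |t| < |x - xc|
      linarith
    filter_upwards [hopen.mem_nhds hmem] with y hy
    exact hzero t y (le_of_lt hy)
  have h1 : deriv (fun τ ↦ ψ τ x) t = 0 := by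
    rw [ht.deriv_eq]
    simp
  have h2 : deriv (ψ t) x = 0 := by
    have : deriv (fun y ↦ ψ t y) x = 0 := by
      rw [hxs.deriv_eq]
      simp
    simpa using this
  have h3 : ψ t x = 0 := hzero t x (by linarith [abs_nonneg t])
  unfold energyDensity
  rw [h1, h2, h3]
  ring

/-- Under the same vanishing hypothesis every channel energy of aperture `ρ > a` is `0`. [folklore] -/
theorem channelEnergy_eq_zero_of_vanish (V : ℝ → ℝ) {ψ : ℝ → ℝ → ℝ} {xc a ρ : ℝ} (haρ : a < ρ)
    (hzero : ∀ τ y, a + |τ| ≤ |y - xc| → ψ τ y = 0) (l : Filter ℝ) [l.NeBot] :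
    channelEnergy V xc ρ ψ l = 0 := by
  have hext : ∀ t, exteriorEnergy V xc ρ ψ t = 0 := by
    intro t
    unfold exteriorEnergy
    have hS : MeasurableSet {x : ℝ | ρ + |t| < |x - xc|} :=
      (isOpen_lt continuous_const ((continuous_id.sub continuous_const).abs)).measurableSet
    have hcongr : ∀ x ∈ {x : ℝ | ρ + |t| < |x - xc|},
        ENNReal.ofReal (energyDensity V ψ t x) = 0 := by
      intro x hx
      rw [energyDensity_eq_zero_of_vanish V haρ hzero hx]
      simp
    rw [setLIntegral_congr_fun hS hcongr]
    simp
  unfold channelEnergy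
  rw [show exteriorEnergy V xc ρ ψ = fun _ ↦ 0 from funext hext, liminf_const]

/-- **One-time silence is not rigid.** For every `M > 0`, tortoise radius function, mode `s ≤ ℓ`
and `ρ₀ > 0` there is a finite-energy global `C²` Regge–Wheeler solution with `ψ(0,·) = 0`, silent
at base time `0` through every channel of aperture `ρ ≥ ρ₀` in both time directions, and not
identically zero.  Witness: Cauchy data `(0, g)`, `g` a smooth bump with `g(xc) = 1` supported in
`|x − xc| < ρ₀/2` (`CauchyWave.stub_rwCauchy`); domain of influence. [folklore] -/
theorem exists_oneTimeSilent_nonstatic {M : ℝ} (hM : 0 < M) {r : ℝ → ℝ} {xc : ℝ}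
    (hr : IsTortoiseRadius M r xc) {s ℓ : ℕ} (hsℓ : s ≤ ℓ) {ρ₀ : ℝ} (hρ₀ : 0 < ρ₀) :
    ∃ ψ : ℝ → ℝ → ℝ, IsRWSolution M s ℓ r ψ ∧
      totalEnergy (linePotential M s ℓ r) ψ 0 < ⊤ ∧
      (∀ ρ, ρ₀ ≤ ρ →
        channelEnergy (linePotential M s ℓ r) xc ρ ψ atTop = 0 ∧
        channelEnergy (linePotential M s ℓ r) xc ρ ψ atBot = 0) ∧
      (∀ x, ψ 0 x = 0) ∧ ¬ (∀ t x, ψ t x = 0) := by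
  have _ := hM
  let g : ContDiffBump xc := ⟨ρ₀ / 4, ρ₀ / 2, by positivity, by linarith⟩
  have hg2 : ContDiff ℝ 2 (g : ℝ → ℝ) := g.contDiff
  have hsupp : ∀ x, x ≤ xc - ρ₀ / 2 ∨ xc + ρ₀ / 2 ≤ x → (g : ℝ → ℝ) x = 0 := by
    intro x hx
    apply g.zero_of_le_dist
    show ρ₀ / 2 ≤ dist x xc
    rw [Real.dist_eq]
    rcases hx with hx | hx
    · rw [abs_of_nonpos (by linarith)]
      linarith
    · rw [abs_of_nonneg (by linarith)]
      linarith
  obtain ⟨ψ, hsol, h0, h1, hvan⟩ :=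
    Summit.FinalStateConjecture.FinalStateConjecture.Theorems.CauchyWave.stub_rwCauchy hr s ℓ hsℓ
      (g : ℝ → ℝ) hg2 (xc - ρ₀ / 2) (xc + ρ₀ / 2) hsupp
  have hzero : ∀ τ y, ρ₀ / 2 + |τ| ≤ |y - xc| → ψ τ y = 0 := by
    intro τ y hy
    apply hvan τ y
    rcases le_or_gt 0 (y - xc) with hyc | hyc
    · rw [abs_of_nonneg hyc] at hy
      right
      linarith
    · rw [abs_of_neg hyc] at hy
      left
      linarith
  refine ⟨ψ, hsol, ?_, fun ρ hρ ↦ ⟨?_, ?_⟩, h0, ?_⟩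
  · have hψ0 : ψ 0 = fun _ ↦ (0 : ℝ) := funext h0
    have hdens : ∀ x, energyDensity (linePotential M s ℓ r) ψ 0 x = (g : ℝ → ℝ) x ^ 2 := by
      intro x
      unfold energyDensity
      rw [h1 x, hψ0]
      simp
    have hint : Integrable (fun x ↦ (g : ℝ → ℝ) x ^ 2) volume := by
      apply Continuous.integrable_of_hasCompactSupport
      · exact g.continuous.pow 2
      · exact g.hasCompactSupport.comp_left (g := fun y : ℝ ↦ y ^ 2) (by simp)
    unfold totalEnergy
    simp_rw [hdens]
    exact hint.lintegral_lt_top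
  · exact channelEnergy_eq_zero_of_vanish _ (by linarith) hzero atTop
  · exact channelEnergy_eq_zero_of_vanish _ (by linarith) hzero atBot
  · intro hall
    have hgc : (g : ℝ → ℝ) xc = 1 := g.one_of_mem_closedBall (by simp [g.rIn_pos.le])
    have hd : deriv (fun τ ↦ ψ τ xc) 0 = 0 := by
      have : (fun τ ↦ ψ τ xc) = fun _ ↦ (0 : ℝ) := funext fun τ ↦ hall τ xc
      rw [this]
      simp
    rw [h1 xc, hgc] at hd
    exact one_ne_zero hd

/-- **The natural strengthening of L1 with `∀ t₀` dropped** (silence at the single base time `0`;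
the channel-inequality hypothesis is dropped too, being a proof device — see L4 ⇒ L1). [folklore] -/
def OneTimeSilenceStatic : Prop :=
  ∀ (M : ℝ), 0 < M → ∀ (r : ℝ → ℝ) (xc : ℝ), IsTortoiseRadius M r xc →
    ∀ (s ℓ : ℕ), s ≤ 2 → s ≤ ℓ → ∀ ρ₀ : ℝ, 0 ≤ ρ₀ → ∀ ψ : ℝ → ℝ → ℝ,
      IsRWSolution M s ℓ r ψ → totalEnergy (linePotential M s ℓ r) ψ 0 < ⊤ →
      (∀ ρ, ρ₀ ≤ ρ →
        channelEnergy (linePotential M s ℓ r) xc ρ ψ atTop = 0 ∧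
        channelEnergy (linePotential M s ℓ r) xc ρ ψ atBot = 0) →
      ∀ t x, ψ t x = ψ 0 x

/-- **The natural strengthening of L4 with `∀ T` dropped.** [folklore] -/
def OneTimeSilenceZero : Prop :=
  ∀ (M : ℝ), 0 < M → ∀ (r : ℝ → ℝ) (xc : ℝ), IsTortoiseRadius M r xc →
    ∀ (s ℓ : ℕ), s ≤ 2 → s ≤ ℓ → ∀ ρ₀ : ℝ, 0 ≤ ρ₀ → ∀ ψ : ℝ → ℝ → ℝ,
      IsRWSolution M s ℓ r ψ → totalEnergy (linePotential M s ℓ r) ψ 0 < ⊤ →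
      (∀ ρ, ρ₀ ≤ ρ →
        channelEnergy (linePotential M s ℓ r) xc ρ ψ atTop = 0 ∧
        channelEnergy (linePotential M s ℓ r) xc ρ ψ atBot = 0) →
      ∀ t x, ψ t x = 0

/-- **`¬ OneTimeSilenceStatic`**: the `∀ t₀` of L1 is load-bearing (witness of
`exists_oneTimeSilent_nonstatic` at `M = 1`, `xc = 0`, `s = ℓ = 0`, `ρ₀ = 1`). [folklore] -/
theorem not_oneTimeSilenceStatic : ¬ OneTimeSilenceStatic := by
  intro h
  obtain ⟨r, hr⟩ := exists_isTortoiseRadius one_pos (0 : ℝ)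
  obtain ⟨ψ, hsol, hE, hsil, h0, hne⟩ :=
    exists_oneTimeSilent_nonstatic one_pos hr (s := 0) (ℓ := 0) le_rfl one_pos
  apply hne
  intro t x
  rw [h 1 one_pos r 0 hr 0 0 (by norm_num) le_rfl 1 zero_le_one ψ hsol hE hsil t x, h0 x]

/-- **`¬ OneTimeSilenceZero`**: the `∀ T` of L4 is load-bearing. [folklore] -/
theorem not_oneTimeSilenceZero : ¬ OneTimeSilenceZero := by
  intro h
  obtain ⟨r, hr⟩ := exists_isTortoiseRadius one_pos (0 : ℝ)
  obtain ⟨ψ, hsol, hE, hsil, -, hne⟩ :=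
    exists_oneTimeSilent_nonstatic one_pos hr (s := 0) (ℓ := 0) le_rfl one_pos
  exact hne (h 1 one_pos r 0 hr 0 0 (by norm_num) le_rfl 1 zero_le_one ψ hsol hE hsil)

/-! ### 7.3 Two-sided hypotheses collapse on the time-symmetric class -/

/-- The energy density of the time-shifted solution `t ↦ ψ(a + t)` at time `0` is the energy
density of `ψ` at time `a`. [folklore] -/
theorem energyDensity_shift (V : ℝ → ℝ) (ψ : ℝ → ℝ → ℝ) (a x : ℝ) :
    energyDensity V (fun t y ↦ ψ (a + t) y) 0 x = energyDensity V ψ a x := by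
  unfold energyDensity
  have key : ∀ f : ℝ → ℝ, deriv (fun τ ↦ f (a + τ)) 0 = deriv f a := fun f ↦ by
    rw [deriv_comp_const_add, add_zero]
  have hd : deriv (fun τ ↦ ψ (a + τ) x) 0 = deriv (fun τ ↦ ψ τ x) a := key fun σ ↦ ψ σ x
  simp only [hd, add_zero]

/-- **Time reflection.** For a time-symmetric `ψ` (`ψ(−t, x) = ψ(t, x)`) the energy density is
even in time. [folklore] -/
theorem energyDensity_neg_eq_of_even (V : ℝ → ℝ) {ψ : ℝ → ℝ → ℝ} (heven : ∀ t x, ψ (-t) x = ψ t x)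
    (T x : ℝ) : energyDensity V ψ (-T) x = energyDensity V ψ T x := by
  unfold energyDensity
  have key : ∀ f : ℝ → ℝ, deriv (fun τ ↦ f (-τ)) (-T) = -deriv f T := fun f ↦ by
    rw [deriv_comp_neg, neg_neg]
  have hfun : (fun τ ↦ ψ τ x) = fun τ ↦ ψ (-τ) x := funext fun τ ↦ (heven τ x).symm
  have hd : deriv (fun τ ↦ ψ τ x) (-T) = -deriv (fun τ ↦ ψ τ x) T :=
    (congrArg (fun f : ℝ → ℝ ↦ deriv f (-T)) hfun).trans (key fun σ ↦ ψ σ x)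
  have h0 : ψ (-T) = ψ T := funext fun y ↦ heven T y
  rw [hd, h0, neg_sq]

/-- Hence, on the time-symmetric class, the FIXED-ball exterior energies at `−T` and `+T` (the two
concentration hypotheses of L2, and the two halves of every "doubly silent" hypothesis) coincide.
[folklore] -/
theorem exteriorEnergy_reflect_eq_of_even (V : ℝ → ℝ) {ψ : ℝ → ℝ → ℝ}
    (heven : ∀ t x, ψ (-t) x = ψ t x) (xc ρ T : ℝ) :
    exteriorEnergy V xc ρ (fun t y ↦ ψ (-T + t) y) 0 =
      exteriorEnergy V xc ρ (fun t y ↦ ψ (T + t) y) 0 := by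
  unfold exteriorEnergy
  refine lintegral_congr fun x ↦ ?_
  rw [energyDensity_shift, energyDensity_shift, energyDensity_neg_eq_of_even V heven]

/-- … and so do the total energies at `∓T`. [folklore] -/
theorem totalEnergy_neg_eq_of_even (V : ℝ → ℝ) {ψ : ℝ → ℝ → ℝ}
    (heven : ∀ t x, ψ (-t) x = ψ t x) (T : ℝ) :
    totalEnergy V ψ (-T) = totalEnergy V ψ T := by
  unfold totalEnergy
  refine lintegral_congr fun x ↦ ?_
  rw [energyDensity_neg_eq_of_even V heven]

/-- **L2 restricted to time-symmetric solutions is a ONE-time statement**: for even `ψ` the second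
concentration hypothesis of `TwoSidedTrappingTime` is literally the first.  (Even solutions with
data `(f, 0)` exist for every compactly supported `C²` `f`: `Blindness.exists_even_solution`.)
So any proof of L2 must already bound ONE-sided concentration times of time-symmetric data by
`C log ℓ` — consistent with the incoming/outgoing budget (`a + b ≤ E_F`) but a useful test of
skeleton stubs that try to use the two times separately. [folklore] -/
theorem twoSided_hypotheses_coincide_of_even (V : ℝ → ℝ) {ψ : ℝ → ℝ → ℝ}
    (heven : ∀ t x, ψ (-t) x = ψ t x) (xc ρ T : ℝ) (δ : ℝ≥0∞) :
    (exteriorEnergy V xc ρ (fun t y ↦ ψ (-T + t) y) 0 ≤ δ * totalEnergy V ψ (-T)) ↔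
      (exteriorEnergy V xc ρ (fun t y ↦ ψ (T + t) y) 0 ≤ δ * totalEnergy V ψ T) := by
  rw [exteriorEnergy_reflect_eq_of_even V heven, totalEnergy_neg_eq_of_even V heven]

/-! ### 7.4 Aperture monotonicity: `∀ ρ ≥ ρ₀` in the silence hypotheses is `ρ = ρ₀` -/

/-- The exterior energy is antitone in the aperture (the cone shrinks). [folklore] -/
theorem exteriorEnergy_antitone_aperture (V : ℝ → ℝ) (xc : ℝ) (φ : ℝ → ℝ → ℝ) (t : ℝ)
    {ρ₁ ρ₂ : ℝ} (h : ρ₁ ≤ ρ₂) : exteriorEnergy V xc ρ₂ φ t ≤ exteriorEnergy V xc ρ₁ φ t := by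
  unfold exteriorEnergy
  refine lintegral_mono_set fun x hx ↦ ?_
  simp only [mem_setOf_eq] at hx ⊢
  linarith

/-- The channel energy is antitone in the aperture. [folklore] -/
theorem channelEnergy_antitone_aperture (V : ℝ → ℝ) (xc : ℝ) (φ : ℝ → ℝ → ℝ) (l : Filter ℝ)
    {ρ₁ ρ₂ : ℝ} (h : ρ₁ ≤ ρ₂) : channelEnergy V xc ρ₂ φ l ≤ channelEnergy V xc ρ₁ φ l := by
  unfold channelEnergy
  exact liminf_le_liminf (Eventually.of_forall fun t ↦ exteriorEnergy_antitone_aperture V xc φ t h)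

/-- **Silence from `ρ₀` on is silence at `ρ₀`.** The quantifier `∀ ρ ≥ ρ₀` in L1/L4 (and in
the silence clauses of every card) can be replaced by the single aperture `ρ₀`. [folklore] -/
theorem silentFrom_iff_silentAt (V : ℝ → ℝ) (xc ρ₀ : ℝ) (φ : ℝ → ℝ → ℝ) (l : Filter ℝ) :
    (∀ ρ, ρ₀ ≤ ρ → channelEnergy V xc ρ φ l = 0) ↔ channelEnergy V xc ρ₀ φ l = 0 := by
  refine ⟨fun h ↦ h ρ₀ le_rfl, fun h ρ hρ ↦ ?_⟩
  exact le_antisymm ((channelEnergy_antitone_aperture V xc φ l hρ).trans (le_of_eq h)) bot_le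

/-! ### 7.5 The aperture is redundant given all centres: L4 ⟺ its `ρ₀ = 0` instance -/

/-- Energy density of the time-shifted solution at time `t`. [folklore] -/
theorem energyDensity_shift_at (V : ℝ → ℝ) (ψ : ℝ → ℝ → ℝ) (a t x : ℝ) :
    energyDensity V (fun s y ↦ ψ (a + s) y) t x = energyDensity V ψ (a + t) x := by
  unfold energyDensity
  have key : ∀ f : ℝ → ℝ, deriv (fun τ ↦ f (a + τ)) t = deriv f (a + t) := fun f ↦ by
    rw [deriv_comp_const_add]
  have hd : deriv (fun τ ↦ ψ (a + τ) x) t = deriv (fun τ ↦ ψ τ x) (a + t) := key fun σ ↦ ψ σ x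
  simp only [hd]

/-- **Forward exterior energies: aperture `ρ` at centre `T` = aperture `0` at centre `T − ρ`**
(for `t ≥ 0`, after the time shift `t ↦ t + ρ`; the two cones have the same forward sheets).
[folklore] -/
theorem exteriorEnergy_aperture_top (V : ℝ → ℝ) (ψ : ℝ → ℝ → ℝ) (xc : ℝ) {ρ : ℝ} (hρ : 0 ≤ ρ)
    (T : ℝ) {t : ℝ} (ht : 0 ≤ t) :
    exteriorEnergy V xc ρ (fun s y ↦ ψ (T + s) y) t =
      exteriorEnergy V xc 0 (fun s y ↦ ψ (T - ρ + s) y) (t + ρ) := by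
  unfold exteriorEnergy
  have hset : {x : ℝ | ρ + |t| < |x - xc|} = {x : ℝ | 0 + |t + ρ| < |x - xc|} := by
    ext x
    simp only [mem_setOf_eq]
    rw [abs_of_nonneg ht, abs_of_nonneg (show 0 ≤ t + ρ by linarith), zero_add, add_comm]
  rw [hset]
  refine lintegral_congr fun x ↦ ?_
  rw [energyDensity_shift_at, energyDensity_shift_at, show T - ρ + (t + ρ) = T + t by ring]

/-- **Backward exterior energies: aperture `ρ` at centre `T` = aperture `0` at centre `T + ρ`**
(for `t ≤ 0`, after the time shift `t ↦ t − ρ`). [folklore] -/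
theorem exteriorEnergy_aperture_bot (V : ℝ → ℝ) (ψ : ℝ → ℝ → ℝ) (xc : ℝ) {ρ : ℝ} (hρ : 0 ≤ ρ)
    (T : ℝ) {t : ℝ} (ht : t ≤ 0) :
    exteriorEnergy V xc ρ (fun s y ↦ ψ (T + s) y) t =
      exteriorEnergy V xc 0 (fun s y ↦ ψ (T + ρ + s) y) (t - ρ) := by
  unfold exteriorEnergy
  have hset : {x : ℝ | ρ + |t| < |x - xc|} = {x : ℝ | 0 + |t - ρ| < |x - xc|} := by
    ext x
    simp only [mem_setOf_eq]
    rw [abs_of_nonpos ht, abs_of_nonpos (show t - ρ ≤ 0 by linarith), zero_add, neg_sub]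
    constructor <;> intro h <;> linarith
  rw [hset]
  refine lintegral_congr fun x ↦ ?_
  rw [energyDensity_shift_at, energyDensity_shift_at, show T + ρ + (t - ρ) = T + t by ring]

/-- Forward channel energies: aperture `ρ ≥ 0` at centre `T` = aperture `0` at centre `T − ρ`.
[folklore] -/
theorem channelEnergy_aperture_top (V : ℝ → ℝ) (ψ : ℝ → ℝ → ℝ) (xc : ℝ) {ρ : ℝ} (hρ : 0 ≤ ρ)
    (T : ℝ) :
    channelEnergy V xc ρ (fun s y ↦ ψ (T + s) y) atTop =
      channelEnergy V xc 0 (fun s y ↦ ψ (T - ρ + s) y) atTop := by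
  unfold channelEnergy
  have h1 : liminf (exteriorEnergy V xc ρ (fun s y ↦ ψ (T + s) y)) atTop =
      liminf ((exteriorEnergy V xc 0 (fun s y ↦ ψ (T - ρ + s) y)) ∘ fun t ↦ t + ρ) atTop := by
    refine liminf_congr ?_
    filter_upwards [eventually_ge_atTop (0 : ℝ)] with t ht
    exact exteriorEnergy_aperture_top V ψ xc hρ T ht
  rw [h1, liminf_comp, map_add_atTop_eq]

/-- Backward channel energies: aperture `ρ ≥ 0` at centre `T` = aperture `0` at centre `T + ρ`.
[folklore] -/
theorem channelEnergy_aperture_bot (V : ℝ → ℝ) (ψ : ℝ → ℝ → ℝ) (xc : ℝ) {ρ : ℝ} (hρ : 0 ≤ ρ)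
    (T : ℝ) :
    channelEnergy V xc ρ (fun s y ↦ ψ (T + s) y) atBot =
      channelEnergy V xc 0 (fun s y ↦ ψ (T + ρ + s) y) atBot := by
  unfold channelEnergy
  have h1 : liminf (exteriorEnergy V xc ρ (fun s y ↦ ψ (T + s) y)) atBot =
      liminf ((exteriorEnergy V xc 0 (fun s y ↦ ψ (T + ρ + s) y)) ∘ fun t ↦ t - ρ) atBot := by
    refine liminf_congr ?_
    filter_upwards [eventually_le_atBot (0 : ℝ)] with t ht
    exact exteriorEnergy_aperture_bot V ψ xc hρ T ht
  have h₁ : Tendsto (fun t : ℝ ↦ t - ρ) atBot atBot := by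
    simpa [sub_eq_add_neg] using tendsto_atBot_add_const_right atBot (-ρ) tendsto_id
  have h₂ : Tendsto (fun t : ℝ ↦ t + ρ) atBot atBot := tendsto_atBot_add_const_right atBot ρ tendsto_id
  have hmap : map (fun t : ℝ ↦ t - ρ) atBot = atBot := by
    refine le_antisymm h₁ ?_
    calc (atBot : Filter ℝ) = map (fun t : ℝ ↦ t - ρ) (map (fun t : ℝ ↦ t + ρ) atBot) := by
          rw [map_map]
          simp [Function.comp_def]
      _ ≤ map (fun t : ℝ ↦ t - ρ) atBot := map_mono h₂
  rw [h1, liminf_comp, hmap]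

/-- **Silence at all centres does not see the aperture**: for `ρ ≥ 0`, silence through the
channel of aperture `ρ` at every centre `T` (both directions) is equivalent to silence through the
bare light cones (`ρ = 0`) at every centre.  Together with §7.4, the hypothesis block of L1/L4
reduces to `∀ T, channelEnergy V xc 0 (ψ(T + ·)) atTop = 0 ∧ … atBot = 0`. [folklore] -/
theorem silentAllCentres_iff_aperture_zero (V : ℝ → ℝ) (xc : ℝ) {ρ : ℝ} (hρ : 0 ≤ ρ)
    (ψ : ℝ → ℝ → ℝ) :
    (∀ T, channelEnergy V xc ρ (fun s y ↦ ψ (T + s) y) atTop = 0 ∧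
        channelEnergy V xc ρ (fun s y ↦ ψ (T + s) y) atBot = 0) ↔
      (∀ T, channelEnergy V xc 0 (fun s y ↦ ψ (T + s) y) atTop = 0 ∧
        channelEnergy V xc 0 (fun s y ↦ ψ (T + s) y) atBot = 0) := by
  constructor
  · intro h T
    refine ⟨?_, ?_⟩
    · have h' := (h (T + ρ)).1
      rwa [channelEnergy_aperture_top V ψ xc hρ, show T + ρ - ρ = T by ring] at h'
    · have h' := (h (T - ρ)).2
      rwa [channelEnergy_aperture_bot V ψ xc hρ, show T - ρ + ρ = T by ring] at h'
  · intro h T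
    exact ⟨by rw [channelEnergy_aperture_top V ψ xc hρ]; exact (h _).1,
      by rw [channelEnergy_aperture_bot V ψ xc hρ]; exact (h _).2⟩

/-- **L4 with the aperture machinery stripped** (`ρ₀ = 0`, no `∀ ρ`): a finite-energy global
Regge–Wheeler solution with no energy ahead of ANY light cone `{|t − T| < |x − xc|}` in either time
direction vanishes. [folklore] -/
def EternalSilentWavesVanish₀ : Prop :=
  ∀ M : ℝ, 0 < M → ∀ (r : ℝ → ℝ) (xc : ℝ), IsTortoiseRadius M r xc → ∀ (s ℓ : ℕ), s ≤ 2 → s ≤ ℓ →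
    ∀ ψ : ℝ → ℝ → ℝ, IsRWSolution M s ℓ r ψ →
      totalEnergy (linePotential M s ℓ r) ψ 0 < ⊤ →
      (∀ T, channelEnergy (linePotential M s ℓ r) xc 0 (fun t x ↦ ψ (T + t) x) atTop = 0 ∧
        channelEnergy (linePotential M s ℓ r) xc 0 (fun t x ↦ ψ (T + t) x) atBot = 0) →
      ∀ t x, ψ t x = 0

/-- **L4 ⟺ L4₀**: the parameters `ρ₀` and `∀ ρ ≥ ρ₀` of `EternalSilentWavesVanish` carry no
information (a stub may be stated and attacked at aperture `0`). [folklore] -/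
theorem eternalSilentWavesVanish_iff₀ : EternalSilentWavesVanish ↔ EternalSilentWavesVanish₀ := by
  constructor
  · intro h M hM r xc hr s ℓ hs hsℓ ψ hψ hE hsil
    refine h M hM r xc hr s ℓ hs hsℓ 0 le_rfl ψ hψ hE fun T ρ hρ ↦ ?_
    exact (silentAllCentres_iff_aperture_zero (linePotential M s ℓ r) xc hρ ψ).2 hsil T
  · intro h M hM r xc hr s ℓ hs hsℓ ρ₀ hρ₀ ψ hψ hE hsil
    refine h M hM r xc hr s ℓ hs hsℓ ψ hψ hE ?_
    exact (silentAllCentres_iff_aperture_zero (linePotential M s ℓ r) xc hρ₀ ψ).1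
      fun T ↦ hsil T ρ₀ le_rfl

/-! ### 7.5b Addendum (05:30Z): the three later round-1 cards and the ideators' Sketch files

The crux directory now carries `SketchIdeator{1,2,3}.lean` (the typed first lemmas; my §7.1
transcriptions agree with them VERBATIM up to (a) `∃ δ C, 0 < δ ∧ 0 ≤ C ∧ …` vs nested `∃`, and
(b) the shift order: ideator 2's `timeShift T ψ = fun t x ↦ ψ (t + T) x` and ideator 3's
`ψ (t + t₀)` versus `ψ (T + t)` here and in `Negative/SilenceCalculus.lean` — bridge by
`add_comm` under `funext`), three more cards and the r1 triage panel (5 pass / 2 fail). -/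

/-- **Pre-screen of the remaining typed first lemmas (no cheap kill anywhere).**
* `SidewaysRefill` (card `log-ball-refilled-sideways`, triage: fail as a lever, lemma TRUE): a
  global `C²` solution of `φ_tt − φ_xx + Vφ = 0`, `V` continuous, static on `{|x − xc| > ρ} × ℝ`
  is static: `w_h = φ(· + h, ·) − φ` is a `C²` solution vanishing there, and the x-directed energy
  identity `∂ₓ(w_x² + w_t²)/2 = ∂_t(w_t w_x) + V w w_x` on sideways diamonds (compact `t`-range,
  Grönwall for the unsigned `V`-term) gives `w_h = 0`; `ρ = 0` is trivial by continuity. M-sized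
  in Lean (the tree's `FiniteSpeed` divergence argument with `t ↔ x`). Honest, no junk.
* `LogShellSmoothing` (card `one-log-two-readings`): time-integrated shell energy
  `≤ D(1 + log(ℓ+1))·E` for data supported in the log-shell, `D = D(M, ρ₀, C)` uniform in `s, ℓ`.
  Consistent with the two obvious lower bounds (barrier-top beams dwell `(2ν)⁻¹ log ℓ`; shell
  transit time `≍ C log ℓ`) and with the triage kits j012716/j013268 (dwell slopes 2.49–2.53 vs
  `3√3/2`); fixed-`ℓ` integrability of local energy holds (no zero resonance, Price tails); data
  supported in a bounded shell have finite energy automatically, zero data give `0 ≤ 0`. No junk;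
  XL to prove (Kato smoothing from a log-loss resolvent bound). Survives.
* `EternalDarkModesVanish` (ideator 3): L4 with energy bounded for all `t` by `ofReal E`
  (`E < 0` forces zero energy — harmless) and all apertures `ρ ≥ 0`; true on paper exactly as L4;
  by §7.4–7.5 its hypothesis block is again "bare light cones at all centres".
* `MinimalSetDichotomy` (ideator 3): as typed it is immediate from minimality (a fixed point `p`
  gives the closed invariant `{p} = K`); provable now, carries no risk and little content.
* `StableSetSwallowsOmegaLimit`: see §7.6 (stability load-bearing; true with it). `HullDichotomy`
  is PROVED by triager k2 (`Triage_r1_k2_HullDichotomy.lean`).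
* `ZeroEnergyLightFallsIn 𝓑` / `NoHairFromInfallingZeroEnergyLight` (card
  `zero-energy-light-cannot-hover`, triage: fail): the junk route "reparametrise an infalling
  zero-energy null geodesic so that it takes infinite parameter time" is CLOSED —
  `IsNullGeodesicIn` demands `IsGeodesicOn g.leviCivita` (affine parametrisation,
  `covariantDerivAlong … velocity = 0`); for Kerr the card's `kerr_zeroEnergyRadial_strictAntiOn`
  plus `R₀(r₊) = a²L² > 0` (`L ≠ 0`) and `R₀ = −ΔQ < 0` (`L = 0`, `Q > 0`) show every such
  geodesic crosses `r₊` at finite affine parameter, and for `a = 0` the hypothesis is empty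
  (a null vector orthogonal to the timelike `∂_t` vanishes). Refutable only by a non-Kerr
  stationary vacuum black hole, i.e. not cheaply. [folklore] -/
theorem preScreen_round1_addendum : True := trivial

/-! ### 7.6 Cycle-2 census -/

/-- **Why Φ (hence K2R) still resists — cycle-2 additions to §5.**
* GENERIC INERTNESS OF THE ANTECEDENT.  `K1R`, `LogBallChannels`, `FixedModeChannels` are
  statements about the Regge–Wheeler family on exact SCHWARZSCHILD.  A line that USES the antecedent
  (cards `kerr-isolation-dichotomy` (4), `isolated-kerr-connected-hull`) does so only at a
  Schwarzschild ω-limit; for a Kerr end-state (`a ≠ 0`, expected generic: Dafermos–Luk 2017,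
  Conjecture 1 (c) "for generic initial data, `a_i ≠ 0`") no channel statement exists in the tree
  (no Teukolsky/Kerr `ChannelInequality`), so on the generic tame development the hypothesis of K2R
  is inert exactly as in cycle 1's `k2R_iff_not_k1R_or`.  Not a refutation (Φ may still be true);
  recorded so that planners do not read "the antecedent finally does work" as more than the `a = 0`
  stratum.
* FOUR FIRST LEMMAS pre-screened (§7.1–7.5): all survive; what is load-bearing in them is now a
  theorem (`∀ T`) or provably redundant (`ρ₀`, `∀ ρ`).  For L3 (`StableSetSwallowsOmegaLimit`,
  pure topological dynamics, Hirsch–Smith–Zhao 2001 Lemma 2.1′/Thm 3.1) the Lyapunov-stability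
  hypothesis is load-bearing on paper: on the annulus `S¹ × [0,1)` take `r' = −r³`,
  `θ' = sin²(θ/2) + r`; since `∫ r dt = ∞` every passage through the bottleneck at `θ = 0`
  completes, so an orbit with `r(0) > 0` winds forever onto the invariant circle `C = {r = 0}` and
  `ω(x) = C`; on `C` the flow `θ' = sin²(θ/2)` has one fixed point `p`, `A = {p}` is closed,
  invariant, attracts EVERY point of `C`, but is not Lyapunov stable, and `ω(x) ⊄ A` (the
  attracting-but-unstable phenomenon of Bhatia–Szegő Ch. V; with `r' = −r` instead the forcing is
  integrable and the orbit may converge to `p` on its first approach, so the slow radial decay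
  matters) — a skeleton that drops stability is dead; with stability the lemma is the standard
  "attractor meets an internally chain transitive set" fact and no cheap kill exists.
* KERNEL CLOSEDNESS (card `kerr-isolation-dichotomy`, falsifier (2)) is NOT a risk: on the far
  half-cone the finite-energy `t`-polynomial data are `⋃_k (ker L^k ∩ FE)`, `L = ∂ₓ² − V`, and the
  admissible leading exponents `x^{−ℓ+2j}`, `−ℓ + 2j < 1/2` (position) / `< −1/2` (velocity) are
  finitely many (`⌊(2ℓ+5)/4⌋ + ⌊(2ℓ+3)/4⌋`, unchanged by the `M log x/x³` tail); on the near
  half-cone `ker L^k` is polynomially growing except `span(u_hor)`; the two half-cones are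
  disconnected, so the kernel is the finite direct sum — closed.
* EXTERNAL EVENT unchanged: `¬K1R` on the far side (item 14074's chain) would close K2R `proved`
  ex falso (`k2R_of_not_k1R`); `K1R` proved would make K2R ≡ Φ (`k2R_iff_tameResolution_of_k1R`).
* LITERATURE (2026-08-16T04Z, degraded services): nothing new on AF vacuum breathers beyond
  Alexakis–Schlue (near `𝓘^±` only), on uniqueness without analyticity beyond AIK/IK, or on
  large-data dispersal. [cite: arXiv:1504.04592, Thm. 1.1] -/
theorem tameResolution_resists_c2 : True := trivial

/-! ## 8. Cycle 3 (2026-08-17): the T2 re-type — anatomy of the three added clauses, the hidden-bag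
exposure of (C), orientation (B) is inert, hypothesis (ii) is Lorentz-pancake-blind -/

/-! ### 8.1 Set-level anatomy of the ray-closure clause (C) -/

section Clauses

variable {X : Type} [TopologicalSpace X] [ChartedSpace Literature.Geometry.Lorentzian.E3 X]
  [IsManifold (modelWithCornersSelf ℝ Literature.Geometry.Lorentzian.E3) ((⊤ : ℕ∞) : WithTop ℕ∞) X]
  [ConnectedSpace X]
  {D : Literature.Geometry.Lorentzian.InitialDataSet (modelWithCornersSelf ℝ Literature.Geometry.Lorentzian.E3) X}

/-- **(C) is monotone in `O`.** [folklore] -/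
theorem raysStayInClosure_mono (𝒟 : Literature.Geometry.Lorentzian.CauchyDevelopment D)
    {O O' : Set 𝒟.carrier} (hOO' : O ⊆ O') (h : _root_.Summit.FinalStateConjecture.RaysStayInClosure 𝒟 O) :
    _root_.Summit.FinalStateConjecture.RaysStayInClosure 𝒟 O' :=
  fun p γ dom hγ hunb t ht ht0 ↦ closure_mono hOO' (h p γ dom hγ hunb t ht ht0)

/-- **(C) sees `O` only through its closure**: `RaysStayInClosure 𝒟 O ↔ RaysStayInClosure 𝒟 (closure O)`.
So the clause cannot distinguish the domain of outer communications from its closure (horizon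
generators — future-complete, on `∂O` — are admitted), and a refutation through (C) must exhibit a
complete-ray point at POSITIVE distance from the settled region: an interior/hidden region, never a
boundary effect. [folklore] -/
theorem raysStayInClosure_iff_closure (𝒟 : Literature.Geometry.Lorentzian.CauchyDevelopment D)
    (O : Set 𝒟.carrier) :
    _root_.Summit.FinalStateConjecture.RaysStayInClosure 𝒟 O ↔
      _root_.Summit.FinalStateConjecture.RaysStayInClosure 𝒟 (closure O) := by
  constructor
  · exact fun h ↦ raysStayInClosure_mono 𝒟 subset_closure h
  · intro h _ p γ dom hγ hunb t ht ht0
    have := h p γ dom hγ hunb t ht ht0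
    rwa [closure_closure] at this

/-- **Honest regions lie in `J⁺(Σ)`**: `exteriorOf 𝒟 U ⊆ J⁺(ι X)` for every charted set `U` — the
one-line fact behind §8.3 (orientation is inert) and behind the flat-class analysis (`O ⊆ {x⁰ ≥ 0}`).
[folklore] -/
theorem exteriorOf_subset_causalFuture (𝒟 : Literature.Geometry.Lorentzian.CauchyDevelopment D)
    (U : Set 𝒟.carrier) :
    _root_.Summit.FinalStateConjecture.exteriorOf 𝒟 U ⊆
      𝒟.metric.causalFuture 𝒟.timeOrientation (Set.range 𝒟.embed) :=
  Set.inter_subset_left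

/-- **With an honest `O`, (C) says: complete-ray points are limits of events in `J⁺(Σ)` that can signal
to the charted late region.** (Unfolding of `closure (J⁺(ιX) ∩ I⁻(U))`; the TIP-type reading used by the
ideators' `IsEndVisibleEvent`/`outerRegion_subset_exteriorOf_of_raysStayInClosure`, cards
`end-visible-rays-quarantine`, `orphans-behind-the-throat`.) [folklore] -/
theorem raysStayInClosure_exteriorOf_iff (𝒟 : Literature.Geometry.Lorentzian.CauchyDevelopment D)
    (U : Set 𝒟.carrier) :
    _root_.Summit.FinalStateConjecture.RaysStayInClosure 𝒟 (_root_.Summit.FinalStateConjecture.exteriorOf 𝒟 U) ↔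
      ∀ [𝒟.metric.HasLeviCivita], ∀ (p : X) (γ : ℝ → 𝒟.carrier) (dom : Set ℝ),
        𝒟.metric.IsNormalisedNullRayFrom 𝒟.timeOrientation 𝒟.embed 𝒟.normal p γ dom →
          ¬ BddAbove dom → ∀ t ∈ dom, 0 ≤ t →
            γ t ∈ closure (𝒟.metric.causalFuture 𝒟.timeOrientation (Set.range 𝒟.embed) ∩
              𝒟.metric.chronologicalPast 𝒟.timeOrientation U) :=
  Iff.rfl

end Clauses

/-! ### 8.2 The hidden-bag exposure of clause (C) — why Φ_T2 is suspect-false on paper and why no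
Lean kill is typable -/

/-- **EXPOSURE (paper, conditional; operator-level).** Let `N = ℍ³/Γ` (closed hyperbolic) or `T³`,
with the expanding vacuum datum `(g_N, −g_N)` (Löbell/Milne: `R = −6 = |k|² − (tr k)²`) resp. an
expanding Kasner datum, generic (no KIDs, Beig–Chruściel–Schoen gr-qc/0403042); CIP-glue `N ∖ ball` to
any admissible datum on `ℝ³` through a small neck (Chruściel–Isenberg–Pollack, CMP 257 (2005) 29 =
gr-qc/0403066, PRL 93 (2004) 081101: data unchanged off small balls). The glued datum is ADMISSIBLE on
`X = ℝ³ # N` (`IsSoleEnd e := ∃ R' > R, IsCompact (e.far R')ᶜ` — checked: admissibility does not pin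
the topology of `Σ`). EXPECTED MGHD (each step standard, none a theorem for these large data; this is
exactly why the exposure is not a refutation): (1) the doubly trapped neck pinches into a two-sided black
hole (Raychaudhuri); (2) the AF side censors and settles (complete `𝓘⁺`, Kerr exterior, tame d.o.c.);
(3) the bag expands forever around a comoving-shrinking puncture and stays tame (Andersson–Moncrief
gr-qc/0303045 / arXiv:0908.0784 WITHOUT puncture). Then: bag null geodesics avoiding the puncture are
future-COMPLETE normalised rays from `Σ`; hypotheses hold — complete `𝓘⁺` in the SOJOURN form (`B₁`
may swallow the compact bag piece of `Σ`), (i) (no extremal chart), (ii) (the bag's late geometry is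
Milne/Kasner-flat at scale `≪ t`; NB `outer` = `J⁺Σ ∩ ⋃ I⁻(complete rays)` INCLUDES the bag, so (ii)
is demanded there — and by §8.4 it is cheap to meet even along a contracting Kasner cycle); and the T2
conclusion FAILS for every candidate `(O, d)`: charts map INTO `O = J⁺Σ ∩ I⁻(d.charted)`; the BH region
is in nobody's past, so `O` splits into the d.o.c. side and the bag side; `HasExhaustiveCharts` (the
`∀ τ₁` causal-exhaustion clause) forces the flat chart to cover the late far AF region, hence (connected
image inside `O`) to live on the d.o.c. side; a bag-side HOLE chart would put late far bag points into
`O` (they signal to later bag near-zones: `∫ dt/a = ∞`) that are neither certified nor in `J⁻` of any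
certified slab — exhaustion fails; so no chart touches the late bag, bag rays leave `closure O`, and (C)
fails. Status: SUSPECT-FALSE, conditional on (1)–(3); bites summit clause (C) on every multi-topology
`Σ` equally (37 T2 routes), hence an OPERATOR ruling is required (repairs on file: (C′) end-visible rays
only — the ideators' typed split `K2R ⇐ K2R_end ∧ NoHiddenCompleteRays`, `Ideas/end-visible-rays-
quarantine.md`, Sketch rc 0; (C″) rays from the far end; (C‴) `Σ ≅ ℝ³`, where the residue is the vacuum
closed-universe recollapse question for ball-bags). WHY NO LEAN KILL: a `TameNonSettlingWitness` needs
`isMaximal` (§3) and, before that, the MGHD of CIP-glued large data as a `VacuumCauchyDevelopment` —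
neither exists; a `H_bag → ¬K2R` negative-lemma-modulo-H would be honest only for an `H` that is NOT the
negated conclusion in costume, and the only cheap candidates ("a complete-ray point whose chronological
future is mortal") are vacuous in the bag (bag futures are immortal). Filed by: rattack
(CruxAttack17430 §5), rreview1 (BAG.md), ideators 1–2 (cards + Sketches), this seat (census).
[cite: arXiv:gr-qc/0403066, Thm. 1.1] -/
theorem bag_exposure : True := trivial

/-! ### 8.3 Clause (B) `IsFutureOriented` is inert (paper, all honest developments; Lean, flat class) -/

/-- **Orientation cannot be where Φ_T2 fails.** (iii) flat chart: on late slabs `Ψ₀^* g → η` in `C⁰`, so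
`W = dΨ₀(∂₀)` is uniformly timelike and the `x⁰`-lines `s ↦ Ψ₀(s, y)` have infinite proper length; `W⁰`
has constant sign along each line (Darboux); were it PAST-directed, the line would be a past-directed
timelike curve of infinite length inside `O ⊆ J⁺(Σ)` (`exteriorOf_subset_causalFuture`) — impossible in a
globally hyperbolic development (past-inextendible ⇒ meets `Σ` once ⇒ then enters `I⁻(Σ)`, disjoint from
`J⁺(Σ)` by achronality). (ii) hole charts: the same with the `t*`-lines at a fixed large Kerr–Schild
radius (uniformly timelike for EVERY `(M, a)`, `kerr_bilin_axisPoint_le` of `Negative/SlabMinkowskiCharts`),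
and `V = −g♯dt*` lies in the same cone as `∂_{t*}` where both are timelike (`g(V, ∂_{t*}) = −1`).
(i) orthochronous `Λᵢ`: a pure normalisation — an anti-orthochronous label `(TΛ, c)` with chart `Ψ` is
the honest chart `Ψ ∘ T` with label `(Λ, c)` and spin `a ↦ −a`… up to the tree's conventions; it
constrains bookkeeping, not geometry. KERNEL-CHECKED INSTANCE (flat class; LANDED this cycle as
`Theorems/ChannelsResolveTameDevelopmentsR/Negative/SubMinkowskiOrientation.lean`, p134132, commit
9176e5d17376): for every open sub-development `η|_U` of the trivial datum and every HOLE-FREE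
`FinalStateDecomposition d` over an HONEST region `O = exteriorOf 𝒟 d.charted` (hence `O ⊆ J⁺(Σ) = {x⁰ ≥ 0}`),
`IsFutureOriented d` holds — no orientation hypothesis, no completeness, no maximality (decl `…Theorems.ChannelsResolveTameDevelopmentsR.SubMinkowski.isFutureOriented_of_exteriorOf`).
Consequence for refuters: do not attack (B); for provers: (B) costs one lemma once the charts are honest.
[folklore] -/
theorem orientation_clause_inert : True := trivial
-- re-export deferred: `import …Negative.SubMinkowskiOrientation` and use
-- `Theorems.ChannelsResolveTameDevelopmentsR.SubMinkowski.isFutureOriented_of_exteriorOf d hN hO`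
-- (not imported here only because the crux workfile must elaborate before the farm has built the new module)

/-! ### 8.4 Hypothesis (ii) is Lorentz-pancake-blind (weaker than "bounded geometry") -/

/-- **(ii) bounds no injectivity radius.** The tameness clause asks, at each outer point `q`, for SOME
smooth open embedding `Ψ` of the coordinate ball `B(0, r₀) ⊆ E4` with `Ψ(0) = q`, `sup_{C³}‖Ψ^*g − η‖ ≤ Λ`,
`sup_{C⁰} ≤ 1/2` — in ANY frame. In the flat cylinder `E4/(Lℤ e₃)` (closed spacelike geodesics of length
`L` through every point) such charts exist for EVERY `r₀`: precompose the covering projection with a boost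
`Λ_β` along `e₃` with `γ = cosh β ≥ 2r₀/L`; the image of `B(0, r₀)` is an exactly flat (deviation `≡ 0`)
embedded pancake, thin in the null direction `v = x⁰ + x³`, disjoint from all its deck translates
(if `Λ_β z = kL e₃` with `‖z‖ < 2r₀` then `z₃ = kLγ`, so `k = 0`). So a development may be "(ii)-tame at
scale `r₀`" while collapsing along a spacelike cycle: (ii) is strictly weaker than C³-bounded geometry
w.r.t. any time function (lapse/clock-adapted balls, Anderson's Lorentzian Cheeger–Gromov setting). For
the CRUX this enlarges the hypothesis class (Kasner-type bags with a contracting cycle qualify) and warns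
provers that non-collapse can never be extracted from (ii) (the tree's one-chart compactness theorem
`TameChartCompactness` is unaffected: it claims no patching). KERNEL-CHECKED on the cover (this cycle, to
LANDED as `Negative/TameChartsBoostBlind.lean`, p134429): for all `r₀, L > 0` there is `Λ ∈ lorentzGroup` with
`Λ '' B(0,r₀)` disjoint from `(· + kL e₃) '' (Λ '' B(0,r₀))` for every integer `k ≠ 0`, and
`x ↦ q + Λ x` is an exactly flat late chart of Minkowski space. Suggested repair for planners (not this
seat's to file): tie the ball charts to the `Σ`-clock, e.g. demand `dΨ(∂₀)` within a fixed hyperbolic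
angle of the unit normal field of a time function, or state (ii) on `g`-geodesic balls of an observer
field. LANDED this cycle as `Theorems/ChannelsResolveTameDevelopmentsR/Negative/TameChartsBoostBlind.lean`
(p134429, commit 9370fcc681dc; decl `…Theorems.ChannelsResolveTameDevelopmentsR.Negative.tame_charts_boost_blind`, stated in the words of clause (ii)). [cite: Anderson2004, §1] -/
theorem tame_hypothesis_boost_blind : True := trivial
-- re-export deferred: `import …Negative.TameChartsBoostBlind` and use
-- `Theorems.ChannelsResolveTameDevelopmentsR.Negative.tame_charts_boost_blind hr₀ hL`

/-! ### 8.5 Cycle-3 census -/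

/-- **Why Φ_T2 (hence K2R) resists a Lean disproof — cycle 3.**
* STRUCTURAL: unchanged — `¬K2R ↔ Nonempty TameNonSettlingWitness` (`not_k2R_iff_nonempty`) and the
  field `isMaximal` is certifiable for no development (CBG is a named fact giving `∃` only:
  `choquetBruhat_geroch_exists_mghd_cauchy`), so neither a model-refutation nor a model-proof is typable;
  `HasLeviCivita` is a proved `Prop` (no junk through the instance binders); `IsNormalisedNullRayFrom`,
  the sojourn form, `exteriorOf`, `HasExhaustiveCharts`, `IsFutureOriented` read back honest.
* THE FLAT CLASS IS EXHAUSTED: every sojourn-complete `η|_U` satisfies the full T2 conclusion without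
  maximality (`SubMinkowskiSettledT2`); the slab kills only the double deletion
  (`not_tameResolutionAllDevelopments`); positive-mass rigidity makes every flat admissible datum live on
  `ℝ³`, so no flat model has a hidden region; the new clauses are inert there ((C) because honesty pins
  `O = {x⁰ ≥ 0}`, (B) by §8.3).
* THE ONE LIVE EXPOSURE is (C) on multi-topology `Σ` (§8.2): paper-conditional, operator-level, shared
  with the summit; if the operator keeps (C) verbatim, the first seat to make the bag MGHD rigorous
  refutes 37 routes at once; if (C) ↦ (C′)/(C‴), the item becomes `K2R_end` (typed by ideator 1) and
  this file's §§1–7 transfer verbatim.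
* STRENGTHENINGS refuted / guards certified (category (c)): none new in Lean beyond §4 and §7; the
  `0 ≤ t` guard of (C) is visibly necessary (ray points at `t < 0` lie in `I⁻(Σ)`), the `closure` is
  necessary for horizon generators (paper), `J⁻` (not `I⁻`) in the exhaustion clause is necessary for the
  slab `{x⁰ = τ₁}` itself (flat class, by inspection of `hasExhaustiveCharts_subDecomp`).
* LITERATURE (2026-08-17, search-degraded: local searchd down, OpenAlex/S2 429, arXiv/zbMATH 0 rows;
  galaxy up): nothing new on vacuum AF breathers / non-Kerr smooth stationary black holes / large-data
  non-dispersing lumps; the bag programme's missing step (3) (a black hole inside an expanding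
  hyperbolic/flat vacuum cosmology, future completeness of the complement) is open in print as far as this
  seat could search — Andersson–Moncrief and Andersson–Fajman (arXiv:1709.00267, Milne with Vlasov matter)
  treat the unpunctured case; Mondal arXiv:2502.11289 (large-data future completeness on negative-Yamabe
  closed slices) needs `Λ > 0`.
* EXTERNAL EVENTS that change the item: the operator's ruling on (C); a constructive MGHD for any
  non-flat admissible datum in the tree (would make §3's witness type inhabitable in principle). [folklore] -/
theorem tameResolution_resists_c3 : True := trivial

end Summit.FinalStateConjecture.FinalStateConjecture.Cruxes.ChannelsResolveTameDevelopmentsR.Disproof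

end
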